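/-
Copyright: cell `langlands-arthur-audit` (papers/Langlands/langlands-arthur-audit), unit `pub-arthur-down-g32`
(downstream tracer, gen 32).  Ninth file of the exact-support certificates of the downstream register (module M192 of the
cell's MODULE-MAP, CLAIMed in `lean/MODULE-MAP2.md` 2026-08-21T21:1xZ): `DownstreamSupport.lean` … `DownstreamSupport7.lean` and
`DownstreamSupport8.lean` (sections 69–79; v5 ≈ 156,000 bytes = 78 % of the gate's 200 000-byte file cap) are full or CLOSED, so the
certificates continue here, APPEND-ONLY in the same conventions and the same namespace `…Arthur2013.Downstream.Support`; this file imports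
`…DownstreamSupport8` and `…Downstream20` and `…Downstream21` (and, from v4 on, `…Downstream22`); v1 = section 80, the supports of the seventy-seventh tranche
(`Downstream20.lean` v2, third part, unit `pub-arthur-down-g31`: PARAMETERS FOR DEFINITE ORTHOGONAL GROUPS, PARAMODULAR PACKETS, AND A MULTIPLICITY
HYPOTHESIS — C96 `ChenevierKneserParameters`, C160 `JLRSParamodular`, E26 `GuerberoffLinMult` / `GuerberoffLinCritical`; `canon₇₇`, `canon_implications₇₇`,
`seventyseventh_holds_top`, `definiteParamodular_book_cm`, `definiteParamodular_mok_cm`, `definiteParamodular_kmsw_cm`, `definiteParamodular77_regraded`; body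
written and validated by `pub-arthur-down-g31`, filed by this unit) and section 81, the supports of the seventy-eighth tranche (`Downstream21.lean` v1, this
unit: THE RANKIN – SELBERG LINE AFTER LTXZZ — C202 `YLiuAnticycRS`, C23 `LTXIwasawa`, C203 `YLiuRSEigenvariety`; `canon₇₈`, `canon_implications₇₈`,
`rankinSelberg78_all_of`, `seventyeighth_holds_top`, `rankinSelberg_book_cm`, `rankinSelberg_mok_cm`, `rankinSelberg_kmsw_cm`, `rankinSelberg78_regraded`); v2 (this unit) = section 82, the supports of the
seventy-ninth tranche (`Downstream21.lean` v2: THE ARITHMETIC INNER PRODUCT FORMULA LINE UNDER [LL] HYPOTHESIS 6.6 — C19 `LiLiuHypGalois` (HYPOTHESIS node,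
no supplier edge) / `LiLiuChow`, NEW row C204 `LiLiuII`; `canon₇₉`, `canon₇₉no`, `canon_implications₇₉`, `canon_implications₇₉no`, `aipf79_all_of`,
`seventyninth_holds_top`, `aipf79_need_node_top`, `aipf_book_cm`, `aipf_mok_cm`, `aipf_kmsw_cm`, `aipf79_regraded`); v3 (this unit) = section 83, the supports of
the eightieth tranche (`Downstream21.lean` v3: EULER SYSTEMS UNDER MOREL – SUH'S CONDITION (C′) — NEW row C205 Cai – Fan – Lai: `CaiFanLaiEuler`, `CFLCprimeUnitary`,
HYPOTHESIS node `CFLKottwitz`, `CFLEulerUnitary`; `canon₈₀W`, `canon_implications₈₀W`, `cfl80_all_of`, `cflEuler80_of_scope`, `eightieth_holds_top`,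
`cfl80_need_kottwitz_top`, `cfl80_condC_denied_top`, `cfl_book_cm`, `cfl_mok_cm`, `cfl_kmsw_cm`, `cfl80_regraded`); v4 (unit `pub-arthur-down-g33`,
APPEND-ONLY over v3 = p308408) = section 84, the supports of the eighty-first tranche (`Downstream22.lean` v1, NEW module M195: THE FORMAL DEGREE LINE — NEW row B119
Ichino – Lapid – Mao 2017: `ILMllcSO` (hypothesis field ⇐ book), `ILMgeneric` (premise-free), `ILMcor51`, `ILMnonsplit` (⇐ tranche 57's node); NEW row B120
Anantha Krishna B 2026: HYPOTHESIS node `GVffLLC`, `AKBformalDegreeFF`; `canon₈₁W`, `canon_implications₈₁W`, `ilm81_all_of`, `eightyfirst_holds_top`,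
`akb81_need_gv_top`, `ilmNonsplit81_need_node_top`, `ilm81_book_cm`, `ilm81_mok_kmsw_free`, `ilm81_regraded`); v5 (same unit, APPEND-ONLY over v4 =
p310873) = section 85, the supports of the eighty-second tranche (`Downstream22.lean` v2: MR-NUMBER CITERS OF THE BOOK, II — NEW rows C206 Barrera Salazar –
Graham – Williams 2025 (`BGWchar0`, `BGWthmD`, `BGWthmB`, `BGWezc`), C207 X. Zhang 2024/2025 (`XZgalois`, `XZRT`, `XZBK` — through row E1's `Shin`), C208
Boxer – Pilloni 2021 (`BPweakRegLGC` ⇐ Mok ∧ row C141), C209 Enns – Lee 2024 (`ELstableTempered`, `ELmain`); `canon₈₂W`, `canon_implications₈₂W`, `c82_all_of`,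
`shinWeakS_top`, `eightysecond_holds_top`, `c82_book_cm`, `xzRT82_support`, `c82_mok_cm`, `c82_regraded`).  Nothing of the first eight
files is redeclared or changed.
-/
import HarnessLib
import Literature.NumberTheory.Automorphic.Arthur2013.DownstreamSupport8
import Literature.NumberTheory.Automorphic.Arthur2013.Downstream20
import Literature.NumberTheory.Automorphic.Arthur2013.Downstream21
import Literature.NumberTheory.Automorphic.Arthur2013.Downstream22

/-!
# Downstream of Arthur (2013): exact leaf support of the downstream register, ninth file (sections ≥ 80)

**Source reproduced.**  Nothing beyond what `Downstream.lean` … `Downstream21.lean` transcribe (the downstream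
authors' own sentences, cited there chunk by chunk) and what the three leaf-support modules certify
(`Arthur2013/LeafSupport.lean`, `Mok2015/LeafSupport.lean`, `KMSW2014/LeafSupport.lean`: for every leaf a
kernel-checked countermodel of the DAG as typed).  As in the first eight files: a CANONICAL READING assigns to each
typed downstream statement the conjunction of DAG outputs its edge receives, the tranche's edges are shown to hold in
that reading for arbitrary node assignments, and the countermodels then give the « only if » half of each support —
which leaves are load-bearing for which downstream theorem, in the register AS TYPED (a statement about the cell's
transcription, not about the mathematics).  [cite: Arthur2013, §1.5 with AGIKMS2024 l.380-382 (the conditional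
reading whose supports are certified)]

**v1 (section 80; unit `pub-arthur-down-g31`).**  The seventy-seventh tranche (`Downstream20.lean` v2, third part) types PARAMETERS FOR DEFINITE ORTHOGONAL
GROUPS, PARAMODULAR PACKETS, AND A MULTIPLICITY HYPOTHESIS: C96 Chenevier 2022 with Taïbi's appendix (`ChenevierKneserParameters` ⇐ book ∧ `StabInner`), C160
Johnson-Leung – Roberts – Schmidt 2023 (`JLRSParamodular` ⇐ book ∧ C180 ∧ C182), E26 Guerberoff – Lin 2016 (node `GuerberoffLinMult` with supplier edge ⇐ KMSW
in full; `GuerberoffLinCritical` ⇐ node).  Certified here (canonical reading `canon₇₇` over `canon`, `canon₁₉`, `canon₂₀`): every edge holds for arbitrary ν, μ, κ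
(`canon_implications₇₇`); all four hold at the top, KMSW's two sequels granted (`seventyseventh_holds_top`); EXACT SUPPORTS AS TYPED: in the book countermodel
of ANY leaf C96 and C160 FAIL (C96 through the book premise — and, for the four stabilisation leaves, a second time through `StabInner`; C160 directly and
through C180 / C182) while E26's node and theorem HOLD (`definiteParamodular_book_cm`); in Mok's countermodel of ANY leaf C96 and C160 HOLD, E26's node and
theorem FAIL (KMSW read without its import of Mok has no full statements) (`definiteParamodular_mok_cm`); in KMSW's countermodel of ANY leaf l ≠ MokMain C96 and
C160 HOLD, E26 FAILS FOR EVERY SUCH LEAF, the two SEQUELS included — « [kmsw] and their forthcoming sequels » certified load-bearing as typed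
(`definiteParamodular_kmsw_cm`).  In one statement (`definiteParamodular77_regraded`): support(C96) = support(C160) = book 24; support(`GuerberoffLinMult`) =
support(E26 Thm 3.6.1) = every KMSW leaf ∪ Mok 29.

**v1 (section 81; unit `pub-arthur-down-g32`).**  The seventy-eighth tranche (`Downstream21.lean` v1, a NEW register file) types THE RANKIN – SELBERG LINE AFTER
LTXZZ: NEW row C202 Y. Liu 2026 (`YLiuAnticycRS` ⇐ Mok ∧ KMSW's scope ∧ C24 ∧ C14 ∧ C26), row C23 Liu – Tian – Xiao 2024 (`LTXIwasawa` ⇐ C13 ∧ C202 — second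
order, no classification citation of its own), NEW row C203 Y. Liu 2024 (`YLiuRSEigenvariety` ⇐ C13 ∧ C24 ∧ C23).  Certified here (canonical reading `canon₇₈` over
`canon`, `canon₂`, `canon₃₄`): every edge holds for arbitrary ν, μ, κ (`canon_implications₇₈`); all three hold whenever Mok's outputs and KMSW's scope hold
(`rankinSelberg78_all_of`), in particular at the top (`seventyeighth_holds_top`); NO BOOK PREMISE anywhere, so every book countermodel leaves the tranche intact
(`rankinSelberg_book_cm`); in Mok's countermodel of ANY of its leaves ALL THREE FAIL (`rankinSelberg_mok_cm`); in KMSW's countermodel of ANY leaf l ≠ MokMain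
each of the three holds IFF `l.onlyFull` — KMSW's PROVED scope: the two UNWRITTEN SEQUELS are NOT load-bearing, although none of the three papers says on which
part of [KMSW] it rests and two of them do not cite the classification at all (`rankinSelberg_kmsw_cm`).  In one statement (`rankinSelberg78_regraded`):
support(C202) = support(C23) = support(C203) = Mok 29 ∪ KMSW's scope leaves; book 24 ∩ support = ∅.

**v2 (section 82; unit `pub-arthur-down-g32`).**  The seventy-ninth tranche (`Downstream21.lean` v2) types THE ARITHMETIC INNER PRODUCT FORMULA LINE UNDER
[LL] HYPOTHESIS 6.6: row C19's HYPOTHESIS node `LiLiuHypGalois` (Li – Liu 2021, Hypothesis 6.6 — NO supplier edge: the authors name [KSZ] in preparation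
« under the help of [Mok15, KMSW] » / « as long as the full endoscopic classification for unitary groups is obtained »), row C19's Theorem 1.5 `LiLiuChow`
⇐ C19's tranche-2 field `Consumers2.LiLiu` (⇐ KMSW's scope) ∧ node, and NEW row C204 Li – Liu II 2022 `LiLiuII` ⇐ C19 ∧ node (second order).  Certified here
(canonical readings over `canon₂`: `canon₇₉` with the node GRANTED := `True`, `canon₇₉no` with the node DENIED := `False`): every edge holds in both readings for
arbitrary ν, μ, κ (`canon_implications₇₉`, `canon_implications₇₉no`); with the node granted both rows hold whenever KMSW's scope holds (`aipf79_all_of`), in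
particular at the top (`seventyninth_holds_top`); with EVERY input of the three DAGs granted — both KMSW sequels included — and C19's lemmas true, but the node
denied, BOTH ROWS FAIL with every edge valid (`aipf79_need_node_top`: the node is supplied by nothing in the register, exactly the authors' « for which we assume
Hypothesis 6.6 »); NO BOOK PREMISE (`aipf_book_cm`: every book countermodel leaves both rows intact); in Mok's countermodel of ANY of its leaves BOTH FAIL
(`aipf_mok_cm`, through KMSW's import of Mok inside C19's scope premise); in KMSW's countermodel of ANY leaf l ≠ MokMain each row holds IFF `l.onlyFull` —
KMSW's PROVED scope, the sequels NOT load-bearing through any typed edge (`aipf_kmsw_cm`).  In one statement (`aipf79_regraded`): support(`LiLiuChow`) =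
support(C204) = Mok 29 ∪ KMSW's scope leaves ∪ {the node}; book 24 ∩ support = ∅.

**v3 (section 83; unit `pub-arthur-down-g32`).**  The eightieth tranche (`Downstream21.lean` v3) types NEW row C205 Cai – Fan – Lai, arXiv:2410.18392v2 (EULER
SYSTEMS FROM THE RELATIVE LANGLANDS PROGRAMME UNDER MOREL – SUH'S CONDITION (C′)): `CaiFanLaiEuler` (their Corollary 1.7 as printed ⇐ row C69's `Consumers67.MorelSuhSign`),
`CFLCprimeUnitary` (the authors' claim « condition (C′) is known » for their unitary G ⇐ Mok ∧ KMSW in full ∧ `Consumers4.AMRunitary`, the register's declared reading),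
the HYPOTHESIS node `CFLKottwitz` (no supplier edge), and `CFLEulerUnitary` (the unitary Euler systems) with TWO routes: (a) ⇐ corollary ∧ claim ∧ node, (b) ⇐ KMSW's
scope ∧ node through « [LL2021, Proposition 6.9 (1)] ».  Certified here with ONE parametrised reading `canon₈₀W ν μ κ e k` (e := the value of C69's theorem, k :=
the Kottwitz node; `CFLEulerUnitary` := route (a) ∨ route (b)) whose edges hold for every `Consumers67` value and every k (`canon_implications₈₀W`): at the top with
both nodes granted all three statements hold (`eightieth_holds_top`); with every DAG input, both KMSW sequels and row C69's node granted but the Kottwitz node DENIED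
the Euler systems FAIL while the corollary-as-printed and the claim hold (`cfl80_need_kottwitz_top` — the node is load-bearing and supplied by nothing); with row
C69's node DENIED (reading `canon₆₇no`: Morel – Suh's theorem unavailable as typed) and the Kottwitz node granted, the corollary-as-printed FAILS but the Euler
systems HOLD through route (b) (`cfl80_condC_denied_top` — condition (C′) is NOT load-bearing for the unitary Euler systems as typed, by the authors' own
[LL2021] remark); NO BOOK PREMISE (`cfl_book_cm`); in Mok's countermodel of ANY leaf the claim and the Euler systems FAIL (`cfl_mok_cm`); in KMSW's countermodel of
ANY leaf l ≠ MokMain the claim FAILS (it needs KMSW in full: the sequels ARE load-bearing for « (C′) is known » as read) while the Euler systems hold IFF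
`l.onlyFull` — KMSW's proved scope (`cfl_kmsw_cm`).  In one statement (`cfl80_regraded`): support(`CFLEulerUnitary`) = Mok 29 ∪ KMSW scope leaves ∪ {Kottwitz
node}; support(`CFLCprimeUnitary`) = Mok 29 ∪ all 8 KMSW leaves (sequels included); support(`CaiFanLaiEuler`) = {row C69's node}; book 24 ∩ support = ∅.

**v4 (section 84; unit `pub-arthur-down-g33`).**  The eighty-first tranche (`Downstream22.lean` v1, NEW module M195) types THE FORMAL DEGREE LINE: NEW row B119
Ichino – Lapid – Mao, Duke Math. J. 166 (2017) — `ILMllcSO` (the hypothesis « the local Langlands correspondence for SO(2n+1) » with a SUPPLY edge ⇐ the book, typed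
from the authors' attribution), `ILMgeneric` (Theorems 2.1 / 3.3 / 4.7, premise-free), `ILMcor51` (Corollary 5.1 ⇐ hypothesis ∧ generic), `ILMnonsplit` (the §5
reduction for SO(2n+1)^- ⇐ tranche 57's node `Consumers57.LLCoddSO` ∧ Cor. 5.1) — and NEW row B120 Anantha Krishna B, arXiv:2605.26031 (2026) — the HYPOTHESIS
node `GVffLLC` (row B96 Ganapathy – Varma, second-hand, no supplier edge) and `AKBformalDegreeFF` (Theorem 9.1 ⇐ `ILMcor51` ∧ row B61's `Consumers24.BPformalDegree`
∧ node).  Certified here with ONE parametrised reading `canon₈₁W ν v b g` (v := the value of tranche 57's node, b := the value of B61's field, g := the Ganapathy –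
Varma node; the book's output read as `∀ N, ν.Everything N`; μ and κ are not read at all) whose edges hold for every `Consumers57` / `Consumers24` assignment and
every g (`canon_implications₈₁W`): at the top (tranche 57 and tranche 24 read canonically, node granted) all six statements hold (`eightyfirst_holds_top`); with
the Ganapathy – Varma node DENIED at the top B120 FAILS while all of B119 holds (`akb81_need_gv_top` — the node is load-bearing and supplied by nothing); with
tranche 57's node DENIED at the top the non-split statement FAILS while Corollary 5.1 holds (`ilmNonsplit81_need_node_top`); in the book countermodel of ANY of
the 24 leaves (Mok, KMSW at the top; tranches 57 / 24 / 14 / 13 read canonically; every edge valid) `ILMcor51`, `ILMnonsplit` and `AKBformalDegreeFF` FAIL and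
`ILMgeneric` HOLDS (`ilm81_book_cm` — every book leaf load-bearing for the three conditional statements, none for the generic theorems); with Mok read by the
countermodel of ANY of its leaves and KMSW without its Mok import, book at the top, all six statements HOLD (`ilm81_mok_kmsw_free` — support ∩ (Mok ∪ KMSW) =
∅).  In one statement (`ilm81_regraded`): support(`ILMcor51`) = support(`ILMnonsplit`) = the book's 24 leaves; support(`AKBformalDegreeFF`) = book 24 ∪ {the
Ganapathy – Varma node}; support(`ILMgeneric`) = ∅; Mok 29 ∩ support = KMSW 8 ∩ support = ∅.

**v5 (section 85; unit `pub-arthur-down-g33`).**  The eighty-second tranche (`Downstream22.lean` v2) types MR-NUMBER CITERS OF THE BOOK, II — four arithmetic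
consumers found by the full-text search of the held corpus for the book's MR number: NEW rows C206 Barrera Salazar – Graham – Williams arXiv:2508.10225 (2025;
`BGWchar0` ⇐ book, `BGWthmD` ⇐ BGWchar0 ∧ book, `BGWthmB` premise-free, `BGWezc` ⇐ BGWthmD), C207 X. Zhang arXiv:2411.04897v2 (2024/2025; `XZgalois` ⇐ row E1's
`Shin.WeakS` ∧ `Shin.GalRepGLN`, `XZRT` ⇐ XZgalois, `XZBK` ⇐ XZRT ∧ row A3's `Consumers.TaibiInner` ∧ book; the author declares Shin's (H1) « already proved »),
C208 Boxer – Pilloni arXiv:2110.10251 (2021; `BPweakRegLGC` ⇐ Mok ∧ row C141's `Consumers74.FPWeaklyRegular`), C209 Enns – Lee, Doc. Math. 29 (2024) (`ELstableTempered`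
⇐ book ∧ row A4's `Consumers.GeeTaibi` ∧ row A3's `Consumers.TaibiInner`, `ELmain` ⇐ ELstableTempered).  Certified here with ONE parametrised reading `canon₈₂W ν μ w t
gt fp` (w := the value of Shin's `WeakS ∧ GalRepGLN`, t := row A3's field, gt := row A4's field, fp := row C141's field; the book's and Mok's outputs read as `∀ N,
ν.Everything N` / `∀ N, μ.Everything N`) whose edges hold for every `Consumers` / `Shin` / `Consumers74` assignment (`canon_implications₈₂W`): at the top (tranches
1, 74 and Shin read canonically; `shinWeakS_top` evaluates Shin's canonical weak transfer at the top by `weakS_mk`) all ten statements hold (`eightysecond_holds_top`);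
in the book countermodel of ANY of the 24 leaves (Mok, KMSW at the top; every edge valid) the three C206 statements that cite the book, C207's Bloch – Kato theorems
and both C209 statements FAIL, C206's Theorem B and C208 HOLD, and C207's Galois representations / R ≃ 𝕋 hold IFF the removed leaf is outside the NINE leaves of
Shin's weak transfer (`c82_book_cm`, `xzRT82_support` — two-sided, by `shin_weakS_support`: support(`XZRT`) = FL, WFL_split, W4_Thm38, STF_Arthur, TwistedTF,
MW_Stab, SpecGLN, WFL_general, WFL_nonstandard exactly, the last two being the leaves the author calls proved); with the book at the top, Mok read by the
countermodel of ANY of its leaves and KMSW without its Mok import, C208 FAILS and the nine book-side statements HOLD (`c82_mok_cm`).  In one statement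
(`c82_regraded`): support(`BGWthmD`) = support(`BGWezc`) = support(`ELmain`) = support(`XZBK`) = the book's 24 leaves; support(`XZRT`) = Shin's nine; support(`BGWthmB`)
= ∅; support(`BPweakRegLGC`) = Mok's 29 leaves; KMSW ∩ support = ∅ throughout.

**Deliberately not here.**  Any claim about the content or truth of a downstream statement; no new named fact (every
canonical value is written out); no Mathlib, no `axiom`, no `sorry`, no `opaque`.
-/

set_option autoImplicit false

namespace Literature.NumberTheory.Automorphic.Arthur2013

namespace Downstream

namespace Support

/-! ## 80. Seventy-seventh tranche (v1 of this file, after `Downstream20.lean` v2; unit `pub-arthur-down-g31`): supports of PARAMETERS FOR DEFINITE ORTHOGONAL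
GROUPS, PARAMODULAR PACKETS, AND A MULTIPLICITY HYPOTHESIS — C96 `ChenevierKneserParameters`, C160 `JLRSParamodular`, E26 `GuerberoffLinMult` /
`GuerberoffLinCritical`; see the module docstring for the summary of what is certified. -/

section Canon77

variable (ν : Nodes) (μ : Mok2015.Nodes) (κ : KMSW2014.Nodes)

/-- The canonical reading of the seventy-seventh tranche (over `canon`, `canon₁₉`, `canon₂₀`): C96 := book ∧ `canon`'s stabilisation value (FL ∧ WFL_split ∧ WFL_general ∧ STF_Arthur); C160 := book ∧ the canonical values of C180 and C182; `GuerberoffLinMult` := KMSW in full (its supplier edge); E26 Thm 3.6.1 := the node's value. [cite: Chenevier2022Kneser, Thm 6.4 / Thm A.1; JohnsonLeungRobertsSchmidt2023Klingen, Thms 1.4.1–1.4.2; GuerberoffLin2016Galois, (hypomult), Thm 3.6.1 (canonical model; bookkeeping)] -/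
abbrev canon₇₇ : Consumers77 where
  ChenevierKneserParameters := (∀ N, ν.Everything N) ∧ (canon ν μ κ).StabInner
  JLRSParamodular := (∀ N, ν.Everything N) ∧ (canon₁₉ ν μ κ).SchmidtParamodular ∧ (canon₂₀ ν μ κ).SchmidtCAP
  GuerberoffLinMult := (∀ N, κ.Full N)
  GuerberoffLinCritical := (∀ N, κ.Full N)

/-- Every seventy-seventh-tranche edge holds in the canonical reading, for arbitrary ν, μ, κ. [cite: Chenevier2022Kneser, p0037:L4-5; JohnsonLeungRobertsSchmidt2023Klingen, §1.4; GuerberoffLin2016Galois, p0007:L9 (bookkeeping proved here)] -/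
theorem canon_implications₇₇ : Implications77 ν κ (canon ν μ κ) (canon₁₉ ν μ κ) (canon₂₀ ν μ κ) (canon₇₇ ν μ κ) where
  chenevierKneser := fun b t => ⟨b, t⟩
  jlrs := fun b p c => ⟨b, p, c⟩
  guerberoffLinHyp := fun f => f
  guerberoffLin := fun g => g

end Canon77

/-- At the top (every input of the three DAGs, KMSW's two sequels granted) all four statements hold — through `definiteParamodular77_of_rows`, with `canon`'s
stabilisation value and rows C180 / C182 read off the book's inputs. [cite: Chenevier2022Kneser, Thm 6.4; JohnsonLeungRobertsSchmidt2023Klingen, Thm 1.4.2; GuerberoffLin2016Galois, Thm 3.6.1 (bookkeeping proved here)] -/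
theorem seventyseventh_holds_top : ((canon₇₇ νtop μtop κtop).ChenevierKneserParameters ∧ (canon₇₇ νtop μtop κtop).JLRSParamodular ∧ (canon₇₇ νtop μtop κtop).GuerberoffLinMult ∧ (canon₇₇ νtop μtop κtop).GuerberoffLinCritical) :=
  have A := bookInputs_top
  have b : ∀ N, νtop.Everything N := A.everything
  have P := A.published
  have KQ := kmswInputs_top μtop
  have f : ∀ N, κtop.Full N := KQ.1.full mokInputs_top KQ.2
  definiteParamodular77_of_rows (canon_implications₇₇ νtop μtop κtop) b ⟨P.fl, P.wfl_split, A.unwritten.1, P.stf⟩ b ⟨b, b⟩ f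

/-- BOOK SIDE, EXACT SUPPORT AS TYPED: in the book countermodel of ANY leaf `l` (Mok and KMSW at the top; every edge valid) C96 and C160 FAIL (their first premise is the
book at all ranks) while E26's node and theorem HOLD (no book premise). [cite: Chenevier2022Kneser, p0044:L11-12; JohnsonLeungRobertsSchmidt2023Klingen, bibliography [5]; GuerberoffLin2016Galois, p0021:L45 (bookkeeping proved here)] -/
theorem definiteParamodular_book_cm (l : LeafSupport.Leaf) :
    Implications77 (LeafSupport.mkN (LeafSupport.cm l)) κtop (canon (LeafSupport.mkN (LeafSupport.cm l)) μtop κtop) (canon₁₉ (LeafSupport.mkN (LeafSupport.cm l)) μtop κtop) (canon₂₀ (LeafSupport.mkN (LeafSupport.cm l)) μtop κtop) (canon₇₇ (LeafSupport.mkN (LeafSupport.cm l)) μtop κtop) ∧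
      (¬ (canon₇₇ (LeafSupport.mkN (LeafSupport.cm l)) μtop κtop).ChenevierKneserParameters ∧ ¬ (canon₇₇ (LeafSupport.mkN (LeafSupport.cm l)) μtop κtop).JLRSParamodular ∧ (canon₇₇ (LeafSupport.mkN (LeafSupport.cm l)) μtop κtop).GuerberoffLinMult ∧ (canon₇₇ (LeafSupport.mkN (LeafSupport.cm l)) μtop κtop).GuerberoffLinCritical) ∧
      (∀ l', l' ≠ l → (LeafSupport.mkN (LeafSupport.cm l)).leaf l') ∧ ¬ (LeafSupport.mkN (LeafSupport.cm l)).leaf l :=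
  have cmod := LeafSupport.countermodel l
  have n := not_B_cm l
  have KQ := kmswInputs_top μtop
  have f : ∀ N, κtop.Full N := KQ.1.full mokInputs_top KQ.2
  ⟨canon_implications₇₇ _ _ _, ⟨fun h => n h.1, fun h => n h.1, f, f⟩, cmod.2.1, cmod.2.2.1⟩

/-- MOK SIDE, EXACT SUPPORT AS TYPED: in Mok's countermodel of ANY of its leaves (book at the top; KMSW read without its import of Mok, so its full statements fail;
every edge valid) C96 and C160 HOLD, E26's node and theorem FAIL. [cite: GuerberoffLin2016Galois, p0007:L9; Chenevier2022Kneser, p0005:L26-29 (bookkeeping proved here)] -/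
theorem definiteParamodular_mok_cm (l : Mok2015.LeafSupport.Leaf) :
    Mok2015.LeafSupport.Systems (Mok2015.LeafSupport.mkN (Mok2015.LeafSupport.cm l)) ∧
      (∀ l', l' ≠ l → (Mok2015.LeafSupport.mkN (Mok2015.LeafSupport.cm l)).leaf l') ∧ ¬ (Mok2015.LeafSupport.mkN (Mok2015.LeafSupport.cm l)).leaf l ∧
      Implications77 νtop κnoMok (canon νtop (Mok2015.LeafSupport.mkN (Mok2015.LeafSupport.cm l)) κnoMok) (canon₁₉ νtop (Mok2015.LeafSupport.mkN (Mok2015.LeafSupport.cm l)) κnoMok) (canon₂₀ νtop (Mok2015.LeafSupport.mkN (Mok2015.LeafSupport.cm l)) κnoMok) (canon₇₇ νtop (Mok2015.LeafSupport.mkN (Mok2015.LeafSupport.cm l)) κnoMok) ∧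
      ((canon₇₇ νtop (Mok2015.LeafSupport.mkN (Mok2015.LeafSupport.cm l)) κnoMok).ChenevierKneserParameters ∧ (canon₇₇ νtop (Mok2015.LeafSupport.mkN (Mok2015.LeafSupport.cm l)) κnoMok).JLRSParamodular ∧ ¬ (canon₇₇ νtop (Mok2015.LeafSupport.mkN (Mok2015.LeafSupport.cm l)) κnoMok).GuerberoffLinMult ∧ ¬ (canon₇₇ νtop (Mok2015.LeafSupport.mkN (Mok2015.LeafSupport.cm l)) κnoMok).GuerberoffLinCritical) :=
  have cmod := Mok2015.LeafSupport.countermodel l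
  have kf := κnoMok_facts
  have nF : ¬ ∀ N, κnoMok.Full N := fun h => kf.2.2.2.2.2.2 0 (h 0)
  have A := bookInputs_top
  have b : ∀ N, νtop.Everything N := A.everything
  have P := A.published
  ⟨cmod.1, cmod.2.1, cmod.2.2.1, canon_implications₇₇ _ _ _,
    ⟨⟨b, ⟨P.fl, P.wfl_split, A.unwritten.1, P.stf⟩⟩, ⟨b, b, ⟨b, b⟩⟩, nF, nF⟩⟩

/-- KMSW SIDE, EXACT SUPPORT AS TYPED: book and Mok at the top, KMSW's countermodel of a leaf `l ≠ MokMain` (every KMSW edge valid, the other KMSW leaves true; every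
edge valid): C96 and C160 HOLD; E26's node (through its supplier edge) and theorem FAIL FOR EVERY SUCH LEAF, the two SEQUELS included. [claim: KalethaMinguezShinWhite2014, under-review] [cite: GuerberoffLin2016Galois, p0007:L9 (bookkeeping proved here)] -/
theorem definiteParamodular_kmsw_cm (l : KMSW2014.LeafSupport.Leaf) (hl : l ≠ .MokMain) :
    (∃ ωκ, KMSW2014.LeafSupport.Systems (KMSW2014.LeafSupport.mkN (KMSW2014.LeafSupport.cm l)) ωκ) ∧
      (∀ l', l' ≠ l → (KMSW2014.LeafSupport.mkN (KMSW2014.LeafSupport.cm l)).leaf l') ∧ ¬ (KMSW2014.LeafSupport.mkN (KMSW2014.LeafSupport.cm l)).leaf l ∧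
      KMSW2014.E_ImportMok μtop (KMSW2014.LeafSupport.mkN (KMSW2014.LeafSupport.cm l)) ∧
      Implications77 νtop (KMSW2014.LeafSupport.mkN (KMSW2014.LeafSupport.cm l)) (canon νtop μtop (KMSW2014.LeafSupport.mkN (KMSW2014.LeafSupport.cm l))) (canon₁₉ νtop μtop (KMSW2014.LeafSupport.mkN (KMSW2014.LeafSupport.cm l))) (canon₂₀ νtop μtop (KMSW2014.LeafSupport.mkN (KMSW2014.LeafSupport.cm l))) (canon₇₇ νtop μtop (KMSW2014.LeafSupport.mkN (KMSW2014.LeafSupport.cm l))) ∧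
      ((canon₇₇ νtop μtop (KMSW2014.LeafSupport.mkN (KMSW2014.LeafSupport.cm l))).ChenevierKneserParameters ∧ (canon₇₇ νtop μtop (KMSW2014.LeafSupport.mkN (KMSW2014.LeafSupport.cm l))).JLRSParamodular ∧ ¬ (canon₇₇ νtop μtop (KMSW2014.LeafSupport.mkN (KMSW2014.LeafSupport.cm l))).GuerberoffLinMult ∧ ¬ (canon₇₇ νtop μtop (KMSW2014.LeafSupport.mkN (KMSW2014.LeafSupport.cm l))).GuerberoffLinCritical) :=
  have cmod := KMSW2014.LeafSupport.countermodel l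
  have A := bookInputs_top
  have b : ∀ N, νtop.Everything N := A.everything
  have P := A.published
  have nf : ¬ ∀ N, (KMSW2014.LeafSupport.mkN (KMSW2014.LeafSupport.cm l)).Full N :=
    fun h => KMSW2014.LeafSupport.not_full_of_noFull (cmod.2.2.2 0) (h 0)
  ⟨⟨_, cmod.1⟩, cmod.2.1, cmod.2.2.1, fun _ => cmod.2.1 .MokMain (Ne.symm hl), canon_implications₇₇ _ _ _,
    ⟨⟨b, ⟨P.fl, P.wfl_split, A.unwritten.1, P.stf⟩⟩, ⟨b, b, ⟨b, b⟩⟩, nf, nf⟩⟩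

/-- THE SEVENTY-SEVENTH TRANCHE REGRADED, in one statement: (i) at the top all four hold; (ii) in the book countermodel of any leaf C96 and C160 fail, E26 holds; (iii) in
every Mok countermodel C96 and C160 hold, E26 fails; (iv) in every KMSW countermodel (l ≠ MokMain) likewise. [cite: Chenevier2022Kneser, Thm 6.4; JohnsonLeungRobertsSchmidt2023Klingen, Thm 1.4.2; GuerberoffLin2016Galois, Thm 3.6.1 (bookkeeping proved here)] -/
theorem definiteParamodular77_regraded :
    ((canon₇₇ νtop μtop κtop).ChenevierKneserParameters ∧ (canon₇₇ νtop μtop κtop).JLRSParamodular ∧ (canon₇₇ νtop μtop κtop).GuerberoffLinMult ∧ (canon₇₇ νtop μtop κtop).GuerberoffLinCritical) ∧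
      (∀ l : LeafSupport.Leaf, (¬ (canon₇₇ (LeafSupport.mkN (LeafSupport.cm l)) μtop κtop).ChenevierKneserParameters ∧ ¬ (canon₇₇ (LeafSupport.mkN (LeafSupport.cm l)) μtop κtop).JLRSParamodular ∧ (canon₇₇ (LeafSupport.mkN (LeafSupport.cm l)) μtop κtop).GuerberoffLinMult ∧ (canon₇₇ (LeafSupport.mkN (LeafSupport.cm l)) μtop κtop).GuerberoffLinCritical)) ∧
      (∀ l : Mok2015.LeafSupport.Leaf, ((canon₇₇ νtop (Mok2015.LeafSupport.mkN (Mok2015.LeafSupport.cm l)) κnoMok).ChenevierKneserParameters ∧ (canon₇₇ νtop (Mok2015.LeafSupport.mkN (Mok2015.LeafSupport.cm l)) κnoMok).JLRSParamodular ∧ ¬ (canon₇₇ νtop (Mok2015.LeafSupport.mkN (Mok2015.LeafSupport.cm l)) κnoMok).GuerberoffLinMult ∧ ¬ (canon₇₇ νtop (Mok2015.LeafSupport.mkN (Mok2015.LeafSupport.cm l)) κnoMok).GuerberoffLinCritical)) ∧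
      (∀ l : KMSW2014.LeafSupport.Leaf, l ≠ .MokMain → ((canon₇₇ νtop μtop (KMSW2014.LeafSupport.mkN (KMSW2014.LeafSupport.cm l))).ChenevierKneserParameters ∧ (canon₇₇ νtop μtop (KMSW2014.LeafSupport.mkN (KMSW2014.LeafSupport.cm l))).JLRSParamodular ∧ ¬ (canon₇₇ νtop μtop (KMSW2014.LeafSupport.mkN (KMSW2014.LeafSupport.cm l))).GuerberoffLinMult ∧ ¬ (canon₇₇ νtop μtop (KMSW2014.LeafSupport.mkN (KMSW2014.LeafSupport.cm l))).GuerberoffLinCritical)) :=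
  ⟨seventyseventh_holds_top, fun l => (definiteParamodular_book_cm l).2.1, fun l => (definiteParamodular_mok_cm l).2.2.2.2,
    fun l hl => (definiteParamodular_kmsw_cm l hl).2.2.2.2.2⟩

/-! ## 81. Seventy-eighth tranche (v1 of this file, after `Downstream21.lean` v1; unit `pub-arthur-down-g32`): supports of THE RANKIN – SELBERG LINE AFTER
LTXZZ — C202 `YLiuAnticycRS`, C23 `LTXIwasawa`, C203 `YLiuRSEigenvariety`; see the module docstring for the summary of what is certified. -/

section Canon78

variable (ν : Nodes) (μ : Mok2015.Nodes) (κ : KMSW2014.Nodes)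

/-- The canonical reading of the seventy-eighth tranche (over `canon`, `canon₂`, `canon₃₄`): C202 := Mok ∧ KMSW's scope ∧ the canonical values of C24, C14, C26; C23 := the canonical value of C13 ∧ C202's value; C203 := C13's value ∧ C24's value ∧ C23's value. [cite: Liu2026AnticyclotomicRS, Thm 5.2; LiuTianXiao2024Iwasawa, Thm 1.2.3; Liu2024BesselEigenvariety, Thm 1.2 (canonical model; bookkeeping)] -/
abbrev canon₇₈ : Consumers78 where
  YLiuAnticycRS := (∀ N, μ.Everything N) ∧ (∀ N, κ.Scope N) ∧ (canon₃₄ μ κ).BPlocalGGP ∧ (canon₂ ν μ κ).BPLZZii ∧ (canon₂ ν μ κ).BPCZii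
  LTXIwasawa := (canon ν μ κ).LTXZZ ∧
    ((∀ N, μ.Everything N) ∧ (∀ N, κ.Scope N) ∧ (canon₃₄ μ κ).BPlocalGGP ∧ (canon₂ ν μ κ).BPLZZii ∧ (canon₂ ν μ κ).BPCZii)
  YLiuRSEigenvariety := (canon ν μ κ).LTXZZ ∧ (canon₃₄ μ κ).BPlocalGGP ∧ ((canon ν μ κ).LTXZZ ∧
    ((∀ N, μ.Everything N) ∧ (∀ N, κ.Scope N) ∧ (canon₃₄ μ κ).BPlocalGGP ∧ (canon₂ ν μ κ).BPLZZii ∧ (canon₂ ν μ κ).BPCZii))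

/-- Every seventy-eighth-tranche edge holds in the canonical reading, for arbitrary ν, μ, κ. [cite: Liu2026AnticyclotomicRS, l.1339; LiuTianXiao2024Iwasawa, l.6462, l.6646; Liu2024BesselEigenvariety, l.4506 (bookkeeping proved here)] -/
theorem canon_implications₇₈ : Implications78 μ κ (canon ν μ κ) (canon₂ ν μ κ) (canon₃₄ μ κ) (canon₇₈ ν μ κ) where
  yliuAnticyc := fun m s g b c => ⟨m, s, g, b, c⟩
  ltx := fun z y => ⟨z, y⟩
  yliuEigen := fun z g x => ⟨z, g, x⟩

/-- In the canonical reading all three rows hold as soon as Mok's outputs and KMSW's proved scope hold — for arbitrary ν (no book value is read): through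
`rankinSelberg78_of_rows`, with the canonical values of C24, C14, C26 (Mok ∧ scope) and C13 (scope). [cite: Liu2026AnticyclotomicRS, Thm 5.2; LiuTianXiao2024Iwasawa, Thm 1.2.3; Liu2024BesselEigenvariety, Thm 1.2 (bookkeeping proved here)] -/
theorem rankinSelberg78_all_of (m : (∀ N, μ.Everything N)) (s : (∀ N, κ.Scope N)) : ((canon₇₈ ν μ κ).YLiuAnticycRS ∧ (canon₇₈ ν μ κ).LTXIwasawa ∧ (canon₇₈ ν μ κ).YLiuRSEigenvariety) :=
  rankinSelberg78_of_rows (canon_implications₇₈ ν μ κ) m s ⟨m, s⟩ ⟨m, s⟩ ⟨m, s⟩ s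

end Canon78

/-- At the top (every input of Mok's and KMSW's DAGs; the sequels are granted there but not used) all three hold. [cite: Liu2026AnticyclotomicRS, Thm 5.2; LiuTianXiao2024Iwasawa, Thm 1.2.3; Liu2024BesselEigenvariety, Thm 1.2 (bookkeeping proved here)] -/
theorem seventyeighth_holds_top : ((canon₇₈ νtop μtop κtop).YLiuAnticycRS ∧ (canon₇₈ νtop μtop κtop).LTXIwasawa ∧ (canon₇₈ νtop μtop κtop).YLiuRSEigenvariety) :=
  have m : ∀ N, μtop.Everything N := mokInputs_top.everything
  have s : ∀ N, κtop.Scope N := (kmswInputs_top μtop).1.scope mokInputs_top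
  rankinSelberg78_all_of νtop μtop κtop m s

/-- BOOK SIDE, EXACT SUPPORT AS TYPED: the reading mentions the book's nodes only through `canon₂` / `canon` fields it does not read, so in the book countermodel of ANY
leaf `l` (Mok and KMSW at the top) the whole tranche still holds — none of the three texts cites [Art13]. [cite: LiuTianXiao2024Iwasawa, bibliography l.7985-7993; Liu2024BesselEigenvariety, l.5150-5170 (bookkeeping proved here)] -/
theorem rankinSelberg_book_cm (l : LeafSupport.Leaf) :
    Implications78 μtop κtop (canon (LeafSupport.mkN (LeafSupport.cm l)) μtop κtop) (canon₂ (LeafSupport.mkN (LeafSupport.cm l)) μtop κtop) (canon₃₄ μtop κtop) (canon₇₈ (LeafSupport.mkN (LeafSupport.cm l)) μtop κtop) ∧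
      ((canon₇₈ (LeafSupport.mkN (LeafSupport.cm l)) μtop κtop).YLiuAnticycRS ∧ (canon₇₈ (LeafSupport.mkN (LeafSupport.cm l)) μtop κtop).LTXIwasawa ∧ (canon₇₈ (LeafSupport.mkN (LeafSupport.cm l)) μtop κtop).YLiuRSEigenvariety) ∧
      (∀ l', l' ≠ l → (LeafSupport.mkN (LeafSupport.cm l)).leaf l') ∧ ¬ (LeafSupport.mkN (LeafSupport.cm l)).leaf l :=
  have cmod := LeafSupport.countermodel l
  have m : ∀ N, μtop.Everything N := mokInputs_top.everything
  have s : ∀ N, κtop.Scope N := (kmswInputs_top μtop).1.scope mokInputs_top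
  ⟨canon_implications₇₈ _ _ _, rankinSelberg78_all_of _ μtop κtop m s, cmod.2.1, cmod.2.2.1⟩

/-- MOK SIDE, EXACT SUPPORT AS TYPED: in Mok's countermodel of ANY of its leaves (book at the top; KMSW read without its import of Mok; every edge valid) ALL THREE
FAIL — C202 through its Mok premise, C23 and C203 through C202's value inside theirs. [cite: Liu2026AnticyclotomicRS, l.1339 (« [Mok15, KMSW] »); LiuTianXiao2024Iwasawa, l.6646 (bookkeeping proved here)] -/
theorem rankinSelberg_mok_cm (l : Mok2015.LeafSupport.Leaf) :
    Mok2015.LeafSupport.Systems (Mok2015.LeafSupport.mkN (Mok2015.LeafSupport.cm l)) ∧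
      (∀ l', l' ≠ l → (Mok2015.LeafSupport.mkN (Mok2015.LeafSupport.cm l)).leaf l') ∧ ¬ (Mok2015.LeafSupport.mkN (Mok2015.LeafSupport.cm l)).leaf l ∧
      Implications78 (Mok2015.LeafSupport.mkN (Mok2015.LeafSupport.cm l)) κnoMok (canon νtop (Mok2015.LeafSupport.mkN (Mok2015.LeafSupport.cm l)) κnoMok) (canon₂ νtop (Mok2015.LeafSupport.mkN (Mok2015.LeafSupport.cm l)) κnoMok) (canon₃₄ (Mok2015.LeafSupport.mkN (Mok2015.LeafSupport.cm l)) κnoMok) (canon₇₈ νtop (Mok2015.LeafSupport.mkN (Mok2015.LeafSupport.cm l)) κnoMok) ∧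
      (¬ (canon₇₈ νtop (Mok2015.LeafSupport.mkN (Mok2015.LeafSupport.cm l)) κnoMok).YLiuAnticycRS ∧ ¬ (canon₇₈ νtop (Mok2015.LeafSupport.mkN (Mok2015.LeafSupport.cm l)) κnoMok).LTXIwasawa ∧ ¬ (canon₇₈ νtop (Mok2015.LeafSupport.mkN (Mok2015.LeafSupport.cm l)) κnoMok).YLiuRSEigenvariety) :=
  have cmod := Mok2015.LeafSupport.countermodel l
  have nm := not_M_cm l
  ⟨cmod.1, cmod.2.1, cmod.2.2.1, canon_implications₇₈ _ _ _,
    ⟨fun h => nm h.1, fun h => nm h.2.1, fun h => nm h.2.2.2.1⟩⟩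

/-- KMSW SIDE, EXACT SUPPORT AS TYPED: Mok at the top, KMSW's countermodel of a leaf `l ≠ MokMain` (every KMSW edge valid, the other KMSW leaves true; every edge
valid): EACH of the three rows HOLDS iff `l.onlyFull` — KMSW's PROVED scope (generic parameters on pure inner forms: the definite U(V_n) × U(V_{n+1}) with
relevant, hence generic, base change; LTXZZ's Proposition 12.3.1 « for generic packets ») — so the two UNWRITTEN SEQUELS `KMS_A`, `KMS_B` are not load-bearing
for this line. [claim: KalethaMinguezShinWhite2014, under-review] [cite: Liu2026AnticyclotomicRS, l.793-797, l.1339; LiuEtAl2022, Prop 12.3.1 (p0120:L4) (bookkeeping proved here)] -/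
theorem rankinSelberg_kmsw_cm (l : KMSW2014.LeafSupport.Leaf) (hl : l ≠ .MokMain) :
    (∃ ωκ, KMSW2014.LeafSupport.Systems (KMSW2014.LeafSupport.mkN (KMSW2014.LeafSupport.cm l)) ωκ) ∧
      (∀ l', l' ≠ l → (KMSW2014.LeafSupport.mkN (KMSW2014.LeafSupport.cm l)).leaf l') ∧ ¬ (KMSW2014.LeafSupport.mkN (KMSW2014.LeafSupport.cm l)).leaf l ∧
      KMSW2014.E_ImportMok μtop (KMSW2014.LeafSupport.mkN (KMSW2014.LeafSupport.cm l)) ∧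
      Implications78 μtop (KMSW2014.LeafSupport.mkN (KMSW2014.LeafSupport.cm l)) (canon νtop μtop (KMSW2014.LeafSupport.mkN (KMSW2014.LeafSupport.cm l))) (canon₂ νtop μtop (KMSW2014.LeafSupport.mkN (KMSW2014.LeafSupport.cm l))) (canon₃₄ μtop (KMSW2014.LeafSupport.mkN (KMSW2014.LeafSupport.cm l))) (canon₇₈ νtop μtop (KMSW2014.LeafSupport.mkN (KMSW2014.LeafSupport.cm l))) ∧
      (((canon₇₈ νtop μtop (KMSW2014.LeafSupport.mkN (KMSW2014.LeafSupport.cm l))).YLiuAnticycRS ↔ l.onlyFull = true) ∧ ((canon₇₈ νtop μtop (KMSW2014.LeafSupport.mkN (KMSW2014.LeafSupport.cm l))).LTXIwasawa ↔ l.onlyFull = true) ∧ ((canon₇₈ νtop μtop (KMSW2014.LeafSupport.mkN (KMSW2014.LeafSupport.cm l))).YLiuRSEigenvariety ↔ l.onlyFull = true)) := by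
  have cmod := KMSW2014.LeafSupport.countermodel l
  have m : ∀ N, μtop.Everything N := mokInputs_top.everything
  have hsc : (∀ N, (KMSW2014.LeafSupport.mkN (KMSW2014.LeafSupport.cm l)).Scope N) ↔ l.onlyFull = true := by
    constructor
    · intro hk
      cases hb : l.onlyFull
      · exact absurd (hk 0) (KMSW2014.LeafSupport.not_scope_of (KMSW2014.LeafSupport.scope_fails l hb 0))
      · rfl
    · intro h
      exact scope_of_onlyFull l h
  have all := fun h : l.onlyFull = true => rankinSelberg78_all_of νtop μtop (KMSW2014.LeafSupport.mkN (KMSW2014.LeafSupport.cm l)) m (hsc.2 h)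
  exact ⟨⟨_, cmod.1⟩, cmod.2.1, cmod.2.2.1, fun _ => cmod.2.1 .MokMain (Ne.symm hl), canon_implications₇₈ _ _ _,
    ⟨⟨fun h => hsc.1 h.2.1, fun h => (all h).1⟩, ⟨fun h => hsc.1 h.1, fun h => (all h).2.1⟩, ⟨fun h => hsc.1 h.1, fun h => (all h).2.2⟩⟩⟩

/-- THE SEVENTY-EIGHTH TRANCHE REGRADED, in one statement: (i) at the top all three hold; (ii) in the book countermodel of any leaf all three still hold (no book
premise); (iii) in every Mok countermodel all three fail; (iv) in every KMSW countermodel (l ≠ MokMain) each of the three ↔ `l.onlyFull`. [cite: Liu2026AnticyclotomicRS, Thm 5.2; LiuTianXiao2024Iwasawa, Thm 1.2.3; Liu2024BesselEigenvariety, Thm 1.2 (bookkeeping proved here)] -/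
theorem rankinSelberg78_regraded :
    ((canon₇₈ νtop μtop κtop).YLiuAnticycRS ∧ (canon₇₈ νtop μtop κtop).LTXIwasawa ∧ (canon₇₈ νtop μtop κtop).YLiuRSEigenvariety) ∧
      (∀ l : LeafSupport.Leaf, (¬ (LeafSupport.mkN (LeafSupport.cm l)).leaf l) ∧ ((canon₇₈ (LeafSupport.mkN (LeafSupport.cm l)) μtop κtop).YLiuAnticycRS ∧ (canon₇₈ (LeafSupport.mkN (LeafSupport.cm l)) μtop κtop).LTXIwasawa ∧ (canon₇₈ (LeafSupport.mkN (LeafSupport.cm l)) μtop κtop).YLiuRSEigenvariety)) ∧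
      (∀ l : Mok2015.LeafSupport.Leaf, (¬ (canon₇₈ νtop (Mok2015.LeafSupport.mkN (Mok2015.LeafSupport.cm l)) κnoMok).YLiuAnticycRS ∧ ¬ (canon₇₈ νtop (Mok2015.LeafSupport.mkN (Mok2015.LeafSupport.cm l)) κnoMok).LTXIwasawa ∧ ¬ (canon₇₈ νtop (Mok2015.LeafSupport.mkN (Mok2015.LeafSupport.cm l)) κnoMok).YLiuRSEigenvariety)) ∧
      (∀ l : KMSW2014.LeafSupport.Leaf, l ≠ .MokMain → (((canon₇₈ νtop μtop (KMSW2014.LeafSupport.mkN (KMSW2014.LeafSupport.cm l))).YLiuAnticycRS ↔ l.onlyFull = true) ∧ ((canon₇₈ νtop μtop (KMSW2014.LeafSupport.mkN (KMSW2014.LeafSupport.cm l))).LTXIwasawa ↔ l.onlyFull = true) ∧ ((canon₇₈ νtop μtop (KMSW2014.LeafSupport.mkN (KMSW2014.LeafSupport.cm l))).YLiuRSEigenvariety ↔ l.onlyFull = true))) :=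
  ⟨seventyeighth_holds_top, fun l => ⟨(rankinSelberg_book_cm l).2.2.2, (rankinSelberg_book_cm l).2.1⟩, fun l => (rankinSelberg_mok_cm l).2.2.2.2,
    fun l hl => (rankinSelberg_kmsw_cm l hl).2.2.2.2.2⟩

/-! ## 82. Seventy-ninth tranche (v2 of this file, after `Downstream21.lean` v2; unit `pub-arthur-down-g32`): supports of THE ARITHMETIC INNER PRODUCT
FORMULA LINE UNDER [LL] HYPOTHESIS 6.6 — C19 `LiLiuHypGalois` (node) / `LiLiuChow`, C204 `LiLiuII`; see the module docstring for the summary of what is certified. -/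

section Canon79

variable (ν : Nodes) (μ : Mok2015.Nodes) (κ : KMSW2014.Nodes)

/-- The canonical reading of the seventy-ninth tranche with the HYPOTHESIS node GRANTED (over `canon₂`): node := `True` (it has no supplier in the register); C19's Theorem 1.5 and C204 := the canonical value of C19's lemmas (`canon₂ …).LiLiu` = KMSW's scope), the granted node absorbed. [cite: LiLiu2021, Thm 1.5, Hyp. 6.6; LiLiu2022ChowII, Thm 1.4 (canonical model; bookkeeping)] -/
abbrev canon₇₉ : Consumers79 where
  LiLiuHypGalois := True
  LiLiuChow := (canon₂ ν μ κ).LiLiu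
  LiLiuII := (canon₂ ν μ κ).LiLiu

/-- The reading with the HYPOTHESIS node DENIED (over `canon₂`): node := `False`; each row := C19's canonical value ∧ `False`. [cite: LiLiu2021, Rem. 6.7 (the node's announced supplier [KSZ] is outside the register) (separating model; bookkeeping)] -/
abbrev canon₇₉no : Consumers79 where
  LiLiuHypGalois := False
  LiLiuChow := (canon₂ ν μ κ).LiLiu ∧ False
  LiLiuII := (canon₂ ν μ κ).LiLiu ∧ False

/-- Both seventy-ninth-tranche edges hold in the node-granted reading, for arbitrary ν, μ, κ. [cite: LiLiu2021, §11 (l.3077-3079); LiLiu2022ChowII, §4.7 (l.4582) (bookkeeping proved here)] -/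
theorem canon_implications₇₉ : Implications79 (canon₂ ν μ κ) (canon₇₉ ν μ κ) where
  liLiuChow := fun h _ => h
  liLiuII := fun h _ => h

/-- Both seventy-ninth-tranche edges ALSO hold in the node-denied reading, for arbitrary ν, μ, κ (each edge receives the node as a premise). [cite: LiLiu2021, Thm 1.5 (« for which we assume Hypothesis 6.6 »); LiLiu2022ChowII, Thm 1.4 (bookkeeping proved here)] -/
theorem canon_implications₇₉no : Implications79 (canon₂ ν μ κ) (canon₇₉no ν μ κ) where
  liLiuChow := fun h n => ⟨h, n⟩
  liLiuII := fun h n => ⟨h, n⟩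

/-- In the node-granted reading both rows hold as soon as KMSW's proved scope holds — for arbitrary ν and μ (no book value, no Mok value is read directly): through
`aipf79_of_rows` with C19's canonical value. [cite: LiLiu2021, Thm 1.5; LiLiu2022ChowII, Thm 1.4 (bookkeeping proved here)] [claim: KalethaMinguezShinWhite2014, under-review] -/
theorem aipf79_all_of (s : (∀ N, κ.Scope N)) : ((canon₇₉ ν μ κ).LiLiuChow ∧ (canon₇₉ ν μ κ).LiLiuII) :=
  aipf79_of_rows (canon_implications₇₉ ν μ κ) s trivial

end Canon79

/-- At the top (every input of Mok's and KMSW's DAGs; the sequels are granted there but not used), node granted, both rows hold. [cite: LiLiu2021, Thm 1.5; LiLiu2022ChowII, Thm 1.4 (bookkeeping proved here)] -/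
theorem seventyninth_holds_top : ((canon₇₉ νtop μtop κtop).LiLiuChow ∧ (canon₇₉ νtop μtop κtop).LiLiuII) :=
  have s : ∀ N, κtop.Scope N := (kmswInputs_top μtop).1.scope mokInputs_top
  aipf79_all_of νtop μtop κtop s

/-- THE HYPOTHESIS NODE IS LOAD-BEARING AND SUPPLIED BY NOTHING, AS TYPED: at the top — `BookInputs`, `MokInputs`, `KMSWInputs`, BOTH KMSW sequels, hence KMSW's
full classification, and C19's lemmas all true — the node-denied reading satisfies both edges and BOTH ROWS FAIL: no conjunction of DAG outputs and register rows
yields Theorem 1.5 / Theorem 1.4 without the authors' own hypothesis ([KSZ] is not a node of the register). [cite: LiLiu2021, Thm 1.5 with Rem. 6.7 (l.2172-2181); LiLiu2022ChowII, Thm 1.4 (separating model; bookkeeping proved here)] -/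
theorem aipf79_need_node_top :
    BookInputs νtop ∧ MokInputs μtop ∧ KMSWInputs μtop κtop ∧ κtop.UnwrittenSequels ∧ (∀ N, κtop.Full N) ∧ (canon₂ νtop μtop κtop).LiLiu ∧
      Implications79 (canon₂ νtop μtop κtop) (canon₇₉no νtop μtop κtop) ∧
      ¬ (canon₇₉no νtop μtop κtop).LiLiuHypGalois ∧ (¬ (canon₇₉no νtop μtop κtop).LiLiuChow ∧ ¬ (canon₇₉no νtop μtop κtop).LiLiuII) :=
  have KQ := kmswInputs_top μtop
  have f : ∀ N, κtop.Full N := KQ.1.full mokInputs_top KQ.2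
  have s : ∀ N, κtop.Scope N := KQ.1.scope mokInputs_top
  ⟨bookInputs_top, mokInputs_top, KQ.1, KQ.2, f, s, canon_implications₇₉no _ _ _, id, fun h => h.2, fun h => h.2⟩

/-- BOOK SIDE, EXACT SUPPORT AS TYPED: the readings do not mention the book's nodes at all (C19's value is KMSW's scope), so in the book countermodel of ANY leaf `l`
(Mok and KMSW at the top, node granted) both rows still hold — neither text cites [Art13]. [cite: LiLiu2021, bibliography (l.4306, l.4579: [KMSW], [Mok15] only); LiLiu2022ChowII, bibliography (no classification entry) (bookkeeping proved here)] -/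
theorem aipf_book_cm (l : LeafSupport.Leaf) :
    Implications79 (canon₂ (LeafSupport.mkN (LeafSupport.cm l)) μtop κtop) (canon₇₉ (LeafSupport.mkN (LeafSupport.cm l)) μtop κtop) ∧
      ((canon₇₉ (LeafSupport.mkN (LeafSupport.cm l)) μtop κtop).LiLiuChow ∧ (canon₇₉ (LeafSupport.mkN (LeafSupport.cm l)) μtop κtop).LiLiuII) ∧
      (∀ l', l' ≠ l → (LeafSupport.mkN (LeafSupport.cm l)).leaf l') ∧ ¬ (LeafSupport.mkN (LeafSupport.cm l)).leaf l :=
  have cmod := LeafSupport.countermodel l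
  have s : ∀ N, κtop.Scope N := (kmswInputs_top μtop).1.scope mokInputs_top
  ⟨canon_implications₇₉ _ _ _, aipf79_all_of _ μtop κtop s, cmod.2.1, cmod.2.2.1⟩

/-- MOK SIDE, EXACT SUPPORT AS TYPED: in Mok's countermodel of ANY of its leaves (book at the top; KMSW read without its import of Mok, `κnoMok`; node granted; every
edge valid) BOTH ROWS FAIL — through C19's premise, KMSW's scope, which imports Mok's main theorems. [cite: LiLiu2021, Lemma 3.15 / Lemma 9.2 (« [KMSW] Theorem 1.7.1 »); LiLiu2022ChowII, l.4348 (bookkeeping proved here)] [claim: KalethaMinguezShinWhite2014, under-review] -/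
theorem aipf_mok_cm (l : Mok2015.LeafSupport.Leaf) :
    Mok2015.LeafSupport.Systems (Mok2015.LeafSupport.mkN (Mok2015.LeafSupport.cm l)) ∧
      (∀ l', l' ≠ l → (Mok2015.LeafSupport.mkN (Mok2015.LeafSupport.cm l)).leaf l') ∧ ¬ (Mok2015.LeafSupport.mkN (Mok2015.LeafSupport.cm l)).leaf l ∧
      Implications79 (canon₂ νtop (Mok2015.LeafSupport.mkN (Mok2015.LeafSupport.cm l)) κnoMok) (canon₇₉ νtop (Mok2015.LeafSupport.mkN (Mok2015.LeafSupport.cm l)) κnoMok) ∧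
      (¬ (canon₇₉ νtop (Mok2015.LeafSupport.mkN (Mok2015.LeafSupport.cm l)) κnoMok).LiLiuChow ∧ ¬ (canon₇₉ νtop (Mok2015.LeafSupport.mkN (Mok2015.LeafSupport.cm l)) κnoMok).LiLiuII) :=
  have cmod := Mok2015.LeafSupport.countermodel l
  have kf := κnoMok_facts
  have nk : ¬ ∀ N, κnoMok.Scope N := fun h => kf.2.2.2.2.2.1 0 (h 0)
  ⟨cmod.1, cmod.2.1, cmod.2.2.1, canon_implications₇₉ _ _ _, ⟨nk, nk⟩⟩

/-- KMSW SIDE, EXACT SUPPORT AS TYPED: Mok at the top, KMSW's countermodel of a leaf `l ≠ MokMain` (every KMSW edge valid, the other KMSW leaves true; node granted;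
every edge valid): EACH ROW HOLDS iff `l.onlyFull` — KMSW's PROVED scope (tempered, indeed by Assumption 1.3 cuspidal tempered, π on the unitary groups U(V) of
hermitian spaces, i.e. pure inner forms) — so the two UNWRITTEN SEQUELS `KMS_A`, `KMS_B` are not load-bearing through any typed edge; they occur only in the
authors' prose about the node's eventual supplier (« as long as the full endoscopic classification for unitary groups is obtained »). [claim: KalethaMinguezShinWhite2014, under-review] [cite: LiLiu2021, l.1732, l.2730 (« tempered global L-packets [KMSW] Theorem 1.7.1 »), Rem. 6.7 (3) (l.2179) (bookkeeping proved here)] -/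
theorem aipf_kmsw_cm (l : KMSW2014.LeafSupport.Leaf) (hl : l ≠ .MokMain) :
    (∃ ωκ, KMSW2014.LeafSupport.Systems (KMSW2014.LeafSupport.mkN (KMSW2014.LeafSupport.cm l)) ωκ) ∧
      (∀ l', l' ≠ l → (KMSW2014.LeafSupport.mkN (KMSW2014.LeafSupport.cm l)).leaf l') ∧ ¬ (KMSW2014.LeafSupport.mkN (KMSW2014.LeafSupport.cm l)).leaf l ∧
      KMSW2014.E_ImportMok μtop (KMSW2014.LeafSupport.mkN (KMSW2014.LeafSupport.cm l)) ∧
      Implications79 (canon₂ νtop μtop (KMSW2014.LeafSupport.mkN (KMSW2014.LeafSupport.cm l))) (canon₇₉ νtop μtop (KMSW2014.LeafSupport.mkN (KMSW2014.LeafSupport.cm l))) ∧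
      (((canon₇₉ νtop μtop (KMSW2014.LeafSupport.mkN (KMSW2014.LeafSupport.cm l))).LiLiuChow ↔ l.onlyFull = true) ∧ ((canon₇₉ νtop μtop (KMSW2014.LeafSupport.mkN (KMSW2014.LeafSupport.cm l))).LiLiuII ↔ l.onlyFull = true)) := by
  have cmod := KMSW2014.LeafSupport.countermodel l
  have hsc : (∀ N, (KMSW2014.LeafSupport.mkN (KMSW2014.LeafSupport.cm l)).Scope N) ↔ l.onlyFull = true := by
    constructor
    · intro hk
      cases hb : l.onlyFull
      · exact absurd (hk 0) (KMSW2014.LeafSupport.not_scope_of (KMSW2014.LeafSupport.scope_fails l hb 0))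
      · rfl
    · intro h
      exact scope_of_onlyFull l h
  exact ⟨⟨_, cmod.1⟩, cmod.2.1, cmod.2.2.1, fun _ => cmod.2.1 .MokMain (Ne.symm hl), canon_implications₇₉ _ _ _, ⟨hsc, hsc⟩⟩

/-- THE SEVENTY-NINTH TRANCHE REGRADED, in one statement: (i) at the top, node granted, both rows hold; (ii) at the top with the node denied both fail, every edge
valid; (iii) in the book countermodel of any leaf both still hold (no book premise); (iv) in every Mok countermodel both fail; (v) in every KMSW countermodel
(l ≠ MokMain) each row ↔ `l.onlyFull`. [cite: LiLiu2021, Thm 1.5, Hyp. 6.6, Rem. 6.7; LiLiu2022ChowII, Thm 1.4 (bookkeeping proved here)] -/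
theorem aipf79_regraded :
    ((canon₇₉ νtop μtop κtop).LiLiuChow ∧ (canon₇₉ νtop μtop κtop).LiLiuII) ∧
      (Implications79 (canon₂ νtop μtop κtop) (canon₇₉no νtop μtop κtop) ∧ (¬ (canon₇₉no νtop μtop κtop).LiLiuChow ∧ ¬ (canon₇₉no νtop μtop κtop).LiLiuII)) ∧
      (∀ l : LeafSupport.Leaf, (¬ (LeafSupport.mkN (LeafSupport.cm l)).leaf l) ∧ ((canon₇₉ (LeafSupport.mkN (LeafSupport.cm l)) μtop κtop).LiLiuChow ∧ (canon₇₉ (LeafSupport.mkN (LeafSupport.cm l)) μtop κtop).LiLiuII)) ∧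
      (∀ l : Mok2015.LeafSupport.Leaf, (¬ (canon₇₉ νtop (Mok2015.LeafSupport.mkN (Mok2015.LeafSupport.cm l)) κnoMok).LiLiuChow ∧ ¬ (canon₇₉ νtop (Mok2015.LeafSupport.mkN (Mok2015.LeafSupport.cm l)) κnoMok).LiLiuII)) ∧
      (∀ l : KMSW2014.LeafSupport.Leaf, l ≠ .MokMain → (((canon₇₉ νtop μtop (KMSW2014.LeafSupport.mkN (KMSW2014.LeafSupport.cm l))).LiLiuChow ↔ l.onlyFull = true) ∧ ((canon₇₉ νtop μtop (KMSW2014.LeafSupport.mkN (KMSW2014.LeafSupport.cm l))).LiLiuII ↔ l.onlyFull = true))) :=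
  ⟨seventyninth_holds_top, ⟨aipf79_need_node_top.2.2.2.2.2.2.1, aipf79_need_node_top.2.2.2.2.2.2.2.2⟩,
    fun l => ⟨(aipf_book_cm l).2.2.2, (aipf_book_cm l).2.1⟩, fun l => (aipf_mok_cm l).2.2.2.2, fun l hl => (aipf_kmsw_cm l hl).2.2.2.2.2⟩

/-! ## 83. Eightieth tranche (v3 of this file, after `Downstream21.lean` v3; unit `pub-arthur-down-g32`): supports of EULER SYSTEMS UNDER MOREL – SUH'S
CONDITION (C′) — NEW row C205 `CaiFanLaiEuler` / `CFLCprimeUnitary` / `CFLKottwitz` (node) / `CFLEulerUnitary`; see the module docstring for the summary. -/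

section Canon80

variable (ν : Nodes) (μ : Mok2015.Nodes) (κ : KMSW2014.Nodes)

/-- The parametrised canonical reading of the eightieth tranche (over `canon₄`): `e` := the value given to row C69's theorem `MorelSuhSign` (True in `canon₆₇`, False in `canon₆₇no`), `k` := the value of the Kottwitz node; the claim := Mok ∧ KMSW in full ∧ C17-aux's canonical value; the Euler systems := route (a) ∨ route (b). [cite: CaiFanLai2024EulerSatake, Cor. 1.7, Rem. 1.8, §4.3 (canonical model; bookkeeping)] -/
abbrev canon₈₀W (e k : Prop) : Consumers80 where
  CaiFanLaiEuler := e
  CFLCprimeUnitary := (∀ N, μ.Everything N) ∧ (∀ N, κ.Full N) ∧ (canon₄ ν μ κ).AMRunitary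
  CFLKottwitz := k
  CFLEulerUnitary := (e ∧ ((∀ N, μ.Everything N) ∧ (∀ N, κ.Full N) ∧ (canon₄ ν μ κ).AMRunitary) ∧ k) ∨ ((∀ N, κ.Scope N) ∧ k)

/-- Every eightieth-tranche edge holds in the parametrised reading, for arbitrary ν, μ, κ, for EVERY assignment of row C69's fields and every value of the Kottwitz node. [cite: CaiFanLai2024EulerSatake, §4.3 steps 1-2 (l.985-996), Rem. 1.8 (l.288-293) (bookkeeping proved here)] -/
theorem canon_implications₈₀W (c₆₇ : Consumers67) (k : Prop) : Implications80 μ κ (canon₄ ν μ κ) c₆₇ (canon₈₀W ν μ κ c₆₇.MorelSuhSign k) where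
  caiFanLai := fun e => e
  cprimeUnitary := fun m f a => ⟨m, f, a⟩
  eulerUnitary := fun e p n => Or.inl ⟨e, p, n⟩
  eulerUnitaryViaLL := fun s n => Or.inr ⟨s, n⟩

/-- In the parametrised reading all three statements hold as soon as row C69's theorem holds, the Kottwitz node holds, and Mok's outputs and KMSW's FULL classification
hold — for arbitrary ν (no book value is read): through `caiFanLai80_of_rows` (route (a)). [cite: CaiFanLai2024EulerSatake, Cor. 1.7 with Rem. 1.8 (bookkeeping proved here)] [claim: KalethaMinguezShinWhite2014, under-review] -/
theorem cfl80_all_of (c₆₇ : Consumers67) (k : Prop) (h69 : c₆₇.MorelSuhSign) (hk : k) (m : ∀ N, μ.Everything N) (f : ∀ N, κ.Full N) :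
    ((canon₈₀W ν μ κ c₆₇.MorelSuhSign k).CaiFanLaiEuler ∧ (canon₈₀W ν μ κ c₆₇.MorelSuhSign k).CFLCprimeUnitary ∧ (canon₈₀W ν μ κ c₆₇.MorelSuhSign k).CFLEulerUnitary) :=
  caiFanLai80_of_rows (canon_implications₈₀W ν μ κ c₆₇ k) h69 m f m hk

/-- In the parametrised reading the unitary Euler systems hold as soon as KMSW's PROVED scope and the Kottwitz node hold — whatever the value of row C69's theorem
(route (b)). [cite: CaiFanLai2024EulerSatake, §4.3 step 1 (l.991) (bookkeeping proved here)] [claim: KalethaMinguezShinWhite2014, under-review] -/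
theorem cflEuler80_of_scope (c₆₇ : Consumers67) (k : Prop) (hk : k) (s : ∀ N, κ.Scope N) : (canon₈₀W ν μ κ c₆₇.MorelSuhSign k).CFLEulerUnitary :=
  cflEulerUnitary_of_scope (canon_implications₈₀W ν μ κ c₆₇ k) s hk

end Canon80

/-- At the top (every input of the three DAGs, sequels included; row C69's node granted — reading `canon₆₇`; Kottwitz node granted) all three statements of C205 hold. [cite: CaiFanLai2024EulerSatake, Cor. 1.7 (bookkeeping proved here)] -/
theorem eightieth_holds_top : ((canon₈₀W νtop μtop κtop (canon₆₇ νtop μtop κtop).MorelSuhSign True).CaiFanLaiEuler ∧ (canon₈₀W νtop μtop κtop (canon₆₇ νtop μtop κtop).MorelSuhSign True).CFLCprimeUnitary ∧ (canon₈₀W νtop μtop κtop (canon₆₇ νtop μtop κtop).MorelSuhSign True).CFLEulerUnitary) :=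
  have KQ := kmswInputs_top μtop
  have m : ∀ N, μtop.Everything N := mokInputs_top.everything
  have f : ∀ N, κtop.Full N := KQ.1.full mokInputs_top KQ.2
  cfl80_all_of νtop μtop κtop (canon₆₇ νtop μtop κtop) True trivial trivial m f

/-- THE KOTTWITZ NODE IS LOAD-BEARING AND SUPPLIED BY NOTHING, AS TYPED: at the top — `BookInputs`, `MokInputs`, `KMSWInputs`, BOTH KMSW sequels, hence KMSW's full
classification, and row C69's node and theorem granted — the reading with the Kottwitz node DENIED satisfies every edge; the corollary-as-printed and the claim hold,
the unitary Euler systems FAIL. [cite: CaiFanLai2024EulerSatake, Cor. 1.7 third hypothesis with Rem. 1.8 (l.273, l.292) (separating model; bookkeeping proved here)] -/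
theorem cfl80_need_kottwitz_top :
    BookInputs νtop ∧ MokInputs μtop ∧ KMSWInputs μtop κtop ∧ κtop.UnwrittenSequels ∧ (∀ N, κtop.Full N) ∧ (canon₆₇ νtop μtop κtop).MorelSuhCondC ∧
      Implications80 μtop κtop (canon₄ νtop μtop κtop) (canon₆₇ νtop μtop κtop) (canon₈₀W νtop μtop κtop (canon₆₇ νtop μtop κtop).MorelSuhSign False) ∧
      ¬ (canon₈₀W νtop μtop κtop (canon₆₇ νtop μtop κtop).MorelSuhSign False).CFLKottwitz ∧ (canon₈₀W νtop μtop κtop (canon₆₇ νtop μtop κtop).MorelSuhSign False).CaiFanLaiEuler ∧ (canon₈₀W νtop μtop κtop (canon₆₇ νtop μtop κtop).MorelSuhSign False).CFLCprimeUnitary ∧ ¬ (canon₈₀W νtop μtop κtop (canon₆₇ νtop μtop κtop).MorelSuhSign False).CFLEulerUnitary :=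
  have KQ := kmswInputs_top μtop
  have m : ∀ N, μtop.Everything N := mokInputs_top.everything
  have f : ∀ N, κtop.Full N := KQ.1.full mokInputs_top KQ.2
  ⟨bookInputs_top, mokInputs_top, KQ.1, KQ.2, f, trivial, canon_implications₈₀W _ _ _ _ _, id, trivial, ⟨m, f, m⟩,
    fun h => h.elim (fun a => a.2.2) (fun b => b.2)⟩

/-- ROW C69's NODE (CONDITION (C)) IS NOT LOAD-BEARING FOR THE UNITARY EULER SYSTEMS, AS TYPED — BUT IT IS FOR THE COROLLARY AS PRINTED: at the top with row C69 read
by `canon₆₇no` (its node and theorem DENIED) and the Kottwitz node granted, every edge holds, `CaiFanLaiEuler` FAILS, the claim holds, and `CFLEulerUnitary` HOLDS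
through route (b) — the typed form of « In the unitary case, [LL2021, Proposition 6.9] also suffices for this purpose ». [cite: CaiFanLai2024EulerSatake, Rem. 1.8 (l.291), §4.3 step 1 (l.991) (separating model; bookkeeping proved here)] [claim: KalethaMinguezShinWhite2014, under-review] -/
theorem cfl80_condC_denied_top :
    ¬ (canon₆₇no νtop μtop κtop).MorelSuhCondC ∧ ¬ (canon₆₇no νtop μtop κtop).MorelSuhSign ∧
      Implications80 μtop κtop (canon₄ νtop μtop κtop) (canon₆₇no νtop μtop κtop) (canon₈₀W νtop μtop κtop (canon₆₇no νtop μtop κtop).MorelSuhSign True) ∧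
      ¬ (canon₈₀W νtop μtop κtop (canon₆₇no νtop μtop κtop).MorelSuhSign True).CaiFanLaiEuler ∧ (canon₈₀W νtop μtop κtop (canon₆₇no νtop μtop κtop).MorelSuhSign True).CFLCprimeUnitary ∧ (canon₈₀W νtop μtop κtop (canon₆₇no νtop μtop κtop).MorelSuhSign True).CFLEulerUnitary :=
  have KQ := kmswInputs_top μtop
  have m : ∀ N, μtop.Everything N := mokInputs_top.everything
  have f : ∀ N, κtop.Full N := KQ.1.full mokInputs_top KQ.2
  have s : ∀ N, κtop.Scope N := KQ.1.scope mokInputs_top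
  ⟨id, id, canon_implications₈₀W _ _ _ _ _, id, ⟨m, f, m⟩, cflEuler80_of_scope νtop μtop κtop (canon₆₇no νtop μtop κtop) True trivial s⟩

/-- BOOK SIDE, EXACT SUPPORT AS TYPED: no premise of the tranche reads a book node (row C69's theorem rests on its node alone; the claim reads Mok and KMSW), so in the
book countermodel of ANY leaf `l` (Mok and KMSW at the top, both nodes granted) all three statements still hold — the text cites none of [Art13], [Mok15], [KMSW]. [cite: CaiFanLai2024EulerSatake, bibliography (e-print v2 `SphericalES.bbl`: no classification entry) (bookkeeping proved here)] -/
theorem cfl_book_cm (l : LeafSupport.Leaf) :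
    Implications80 μtop κtop (canon₄ (LeafSupport.mkN (LeafSupport.cm l)) μtop κtop) (canon₆₇ (LeafSupport.mkN (LeafSupport.cm l)) μtop κtop) (canon₈₀W (LeafSupport.mkN (LeafSupport.cm l)) μtop κtop (canon₆₇ (LeafSupport.mkN (LeafSupport.cm l)) μtop κtop).MorelSuhSign True) ∧
      ((canon₈₀W (LeafSupport.mkN (LeafSupport.cm l)) μtop κtop (canon₆₇ (LeafSupport.mkN (LeafSupport.cm l)) μtop κtop).MorelSuhSign True).CaiFanLaiEuler ∧ (canon₈₀W (LeafSupport.mkN (LeafSupport.cm l)) μtop κtop (canon₆₇ (LeafSupport.mkN (LeafSupport.cm l)) μtop κtop).MorelSuhSign True).CFLCprimeUnitary ∧ (canon₈₀W (LeafSupport.mkN (LeafSupport.cm l)) μtop κtop (canon₆₇ (LeafSupport.mkN (LeafSupport.cm l)) μtop κtop).MorelSuhSign True).CFLEulerUnitary) ∧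
      (∀ l', l' ≠ l → (LeafSupport.mkN (LeafSupport.cm l)).leaf l') ∧ ¬ (LeafSupport.mkN (LeafSupport.cm l)).leaf l :=
  have cmod := LeafSupport.countermodel l
  have KQ := kmswInputs_top μtop
  have m : ∀ N, μtop.Everything N := mokInputs_top.everything
  have f : ∀ N, κtop.Full N := KQ.1.full mokInputs_top KQ.2
  ⟨canon_implications₈₀W _ _ _ _ _, cfl80_all_of _ μtop κtop (canon₆₇ (LeafSupport.mkN (LeafSupport.cm l)) μtop κtop) True trivial trivial m f, cmod.2.1, cmod.2.2.1⟩

/-- MOK SIDE, EXACT SUPPORT AS TYPED: in Mok's countermodel of ANY of its leaves (book at the top; KMSW read without its import of Mok, `κnoMok`; both nodes granted; every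
edge valid) the corollary-as-printed HOLDS (row C69's theorem needs only its node), the claim FAILS (Mok premise) and the unitary Euler systems FAIL on both routes
(route (a) through the claim, route (b) through KMSW's scope, which imports Mok). [cite: CaiFanLai2024EulerSatake, Rem. 1.8; MorelSuh2019Sign, p0003:L85-87 (« by work of Mok … and … [KMSW] ») (bookkeeping proved here)] [claim: KalethaMinguezShinWhite2014, under-review] -/
theorem cfl_mok_cm (l : Mok2015.LeafSupport.Leaf) :
    Mok2015.LeafSupport.Systems (Mok2015.LeafSupport.mkN (Mok2015.LeafSupport.cm l)) ∧
      (∀ l', l' ≠ l → (Mok2015.LeafSupport.mkN (Mok2015.LeafSupport.cm l)).leaf l') ∧ ¬ (Mok2015.LeafSupport.mkN (Mok2015.LeafSupport.cm l)).leaf l ∧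
      Implications80 (Mok2015.LeafSupport.mkN (Mok2015.LeafSupport.cm l)) κnoMok (canon₄ νtop (Mok2015.LeafSupport.mkN (Mok2015.LeafSupport.cm l)) κnoMok) (canon₆₇ νtop (Mok2015.LeafSupport.mkN (Mok2015.LeafSupport.cm l)) κnoMok) (canon₈₀W νtop (Mok2015.LeafSupport.mkN (Mok2015.LeafSupport.cm l)) κnoMok (canon₆₇ νtop (Mok2015.LeafSupport.mkN (Mok2015.LeafSupport.cm l)) κnoMok).MorelSuhSign True) ∧
      ((canon₈₀W νtop (Mok2015.LeafSupport.mkN (Mok2015.LeafSupport.cm l)) κnoMok (canon₆₇ νtop (Mok2015.LeafSupport.mkN (Mok2015.LeafSupport.cm l)) κnoMok).MorelSuhSign True).CaiFanLaiEuler ∧ ¬ (canon₈₀W νtop (Mok2015.LeafSupport.mkN (Mok2015.LeafSupport.cm l)) κnoMok (canon₆₇ νtop (Mok2015.LeafSupport.mkN (Mok2015.LeafSupport.cm l)) κnoMok).MorelSuhSign True).CFLCprimeUnitary ∧ ¬ (canon₈₀W νtop (Mok2015.LeafSupport.mkN (Mok2015.LeafSupport.cm l)) κnoMok (canon₆₇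 νtop (Mok2015.LeafSupport.mkN (Mok2015.LeafSupport.cm l)) κnoMok).MorelSuhSign True).CFLEulerUnitary) :=
  have cmod := Mok2015.LeafSupport.countermodel l
  have nm := not_M_cm l
  have kf := κnoMok_facts
  have nk : ¬ ∀ N, κnoMok.Scope N := fun h => kf.2.2.2.2.2.1 0 (h 0)
  ⟨cmod.1, cmod.2.1, cmod.2.2.1, canon_implications₈₀W _ _ _ _ _,
    ⟨trivial, fun h => nm h.1, fun h => h.elim (fun a => nm a.2.1.1) (fun b => nk b.1)⟩⟩

/-- KMSW SIDE, EXACT SUPPORT AS TYPED: Mok at the top, KMSW's countermodel of a leaf `l ≠ MokMain` (every KMSW edge valid, the other KMSW leaves true; both nodes granted;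
every edge valid): the corollary-as-printed HOLDS; the claim « (C′) is known » FAILS FOR EVERY SUCH LEAF — it reads KMSW's FULL classification, so the two UNWRITTEN
SEQUELS `KMS_A`, `KMS_B` are load-bearing for it (the G of Table 1 are inner forms; the non-generic parameters are the sequels' subject); the unitary Euler systems
HOLD iff `l.onlyFull` — KMSW's PROVED scope, through route (b). [claim: KalethaMinguezShinWhite2014, under-review] [cite: CaiFanLai2024EulerSatake, Rem. 1.8 (l.291), §4.3 (l.991); LiLiu2021, Prop. 6.9 (1) proof (l.2207: « [KMSW] Theorem 1.7.1 ») (bookkeeping proved here)] -/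
theorem cfl_kmsw_cm (l : KMSW2014.LeafSupport.Leaf) (hl : l ≠ .MokMain) :
    (∃ ωκ, KMSW2014.LeafSupport.Systems (KMSW2014.LeafSupport.mkN (KMSW2014.LeafSupport.cm l)) ωκ) ∧
      (∀ l', l' ≠ l → (KMSW2014.LeafSupport.mkN (KMSW2014.LeafSupport.cm l)).leaf l') ∧ ¬ (KMSW2014.LeafSupport.mkN (KMSW2014.LeafSupport.cm l)).leaf l ∧
      KMSW2014.E_ImportMok μtop (KMSW2014.LeafSupport.mkN (KMSW2014.LeafSupport.cm l)) ∧
      Implications80 μtop (KMSW2014.LeafSupport.mkN (KMSW2014.LeafSupport.cm l)) (canon₄ νtop μtop (KMSW2014.LeafSupport.mkN (KMSW2014.LeafSupport.cm l))) (canon₆₇ νtop μtop (KMSW2014.LeafSupport.mkN (KMSW2014.LeafSupport.cm l))) (canon₈₀W νtop μtop (KMSW2014.LeafSupport.mkN (KMSW2014.LeafSupport.cm l)) (canon₆₇ νtop μtop (KMSW2014.LeafSupport.mkN (KMSW2014.LeafSupport.cm l))).MorelSuhSign True) ∧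
      ((canon₈₀W νtop μtop (KMSW2014.LeafSupport.mkN (KMSW2014.LeafSupport.cm l)) (canon₆₇ νtop μtop (KMSW2014.LeafSupport.mkN (KMSW2014.LeafSupport.cm l))).MorelSuhSign True).CaiFanLaiEuler ∧ ¬ (canon₈₀W νtop μtop (KMSW2014.LeafSupport.mkN (KMSW2014.LeafSupport.cm l)) (canon₆₇ νtop μtop (KMSW2014.LeafSupport.mkN (KMSW2014.LeafSupport.cm l))).MorelSuhSign True).CFLCprimeUnitary ∧ ((canon₈₀W νtop μtop (KMSW2014.LeafSupport.mkN (KMSW2014.LeafSupport.cm l)) (canon₆₇ νtop μtop (KMSW2014.LeafSupport.mkN (KMSW2014.LeafSupport.cm l))).MorelSuhSign True).CFLEulerUnitary ↔ l.onlyFull = true)) := by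
  have cmod := KMSW2014.LeafSupport.countermodel l
  have nf : ¬ ∀ N, (KMSW2014.LeafSupport.mkN (KMSW2014.LeafSupport.cm l)).Full N := fun h => KMSW2014.LeafSupport.not_full_of_noFull (cmod.2.2.2 0) (h 0)
  have hsc : (∀ N, (KMSW2014.LeafSupport.mkN (KMSW2014.LeafSupport.cm l)).Scope N) ↔ l.onlyFull = true := by
    constructor
    · intro hk
      cases hb : l.onlyFull
      · exact absurd (hk 0) (KMSW2014.LeafSupport.not_scope_of (KMSW2014.LeafSupport.scope_fails l hb 0))
      · rfl
    · intro h
      exact scope_of_onlyFull l h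
  exact ⟨⟨_, cmod.1⟩, cmod.2.1, cmod.2.2.1, fun _ => cmod.2.1 .MokMain (Ne.symm hl), canon_implications₈₀W _ _ _ _ _,
    ⟨trivial, fun h => nf h.2.1, ⟨fun h => h.elim (fun a => absurd a.2.1.2.1 nf) (fun b => hsc.1 b.1), fun h => Or.inr ⟨hsc.2 h, trivial⟩⟩⟩⟩

/-- THE EIGHTIETH TRANCHE REGRADED, in one statement: (i) at the top, both nodes granted, all three hold; (ii) Kottwitz node denied at the top: the Euler systems fail,
every edge valid; (iii) row C69's node denied at the top: the corollary-as-printed fails, the Euler systems hold; (iv) in the book countermodel of any leaf all three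
hold (no book premise); (v) in every Mok countermodel the claim and the Euler systems fail; (vi) in every KMSW countermodel (l ≠ MokMain) the claim fails and the
Euler systems ↔ `l.onlyFull`. [cite: CaiFanLai2024EulerSatake, Cor. 1.7, Rem. 1.8, §4.3 (bookkeeping proved here)] -/
theorem cfl80_regraded :
    ((canon₈₀W νtop μtop κtop (canon₆₇ νtop μtop κtop).MorelSuhSign True).CaiFanLaiEuler ∧ (canon₈₀W νtop μtop κtop (canon₆₇ νtop μtop κtop).MorelSuhSign True).CFLCprimeUnitary ∧ (canon₈₀W νtop μtop κtop (canon₆₇ νtop μtop κtop).MorelSuhSign True).CFLEulerUnitary) ∧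
      (Implications80 μtop κtop (canon₄ νtop μtop κtop) (canon₆₇ νtop μtop κtop) (canon₈₀W νtop μtop κtop (canon₆₇ νtop μtop κtop).MorelSuhSign False) ∧ ¬ (canon₈₀W νtop μtop κtop (canon₆₇ νtop μtop κtop).MorelSuhSign False).CFLEulerUnitary) ∧
      (Implications80 μtop κtop (canon₄ νtop μtop κtop) (canon₆₇no νtop μtop κtop) (canon₈₀W νtop μtop κtop (canon₆₇no νtop μtop κtop).MorelSuhSign True) ∧ ¬ (canon₈₀W νtop μtop κtop (canon₆₇no νtop μtop κtop).MorelSuhSign True).CaiFanLaiEuler ∧ (canon₈₀W νtop μtop κtop (canon₆₇no νtop μtop κtop).MorelSuhSign True).CFLEulerUnitary) ∧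
      (∀ l : LeafSupport.Leaf, (¬ (LeafSupport.mkN (LeafSupport.cm l)).leaf l) ∧ ((canon₈₀W (LeafSupport.mkN (LeafSupport.cm l)) μtop κtop (canon₆₇ (LeafSupport.mkN (LeafSupport.cm l)) μtop κtop).MorelSuhSign True).CaiFanLaiEuler ∧ (canon₈₀W (LeafSupport.mkN (LeafSupport.cm l)) μtop κtop (canon₆₇ (LeafSupport.mkN (LeafSupport.cm l)) μtop κtop).MorelSuhSign True).CFLCprimeUnitary ∧ (canon₈₀W (LeafSupport.mkN (LeafSupport.cm l)) μtop κtop (canon₆₇ (LeafSupport.mkN (LeafSupport.cm l)) μtop κtop).MorelSuhSign True).CFLEulerUnitary)) ∧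
      (∀ l : Mok2015.LeafSupport.Leaf, ¬ (canon₈₀W νtop (Mok2015.LeafSupport.mkN (Mok2015.LeafSupport.cm l)) κnoMok (canon₆₇ νtop (Mok2015.LeafSupport.mkN (Mok2015.LeafSupport.cm l)) κnoMok).MorelSuhSign True).CFLCprimeUnitary ∧ ¬ (canon₈₀W νtop (Mok2015.LeafSupport.mkN (Mok2015.LeafSupport.cm l)) κnoMok (canon₆₇ νtop (Mok2015.LeafSupport.mkN (Mok2015.LeafSupport.cm l)) κnoMok).MorelSuhSign True).CFLEulerUnitary) ∧
      (∀ l : KMSW2014.LeafSupport.Leaf, l ≠ .MokMain → ¬ (canon₈₀W νtop μtop (KMSW2014.LeafSupport.mkN (KMSW2014.LeafSupport.cm l)) (canon₆₇ νtop μtop (KMSW2014.LeafSupport.mkN (KMSW2014.LeafSupport.cm l))).MorelSuhSign True).CFLCprimeUnitary ∧ ((canon₈₀W νtop μtop (KMSW2014.LeafSupport.mkN (KMSW2014.LeafSupport.cm l)) (canon₆₇ νtop μtop (KMSW2014.LeafSupport.mkN (KMSW2014.LeafSupport.cm l))).MorelSuhSign True).CFLEulerUnitary ↔ l.onlyFull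 = true)) :=
  ⟨eightieth_holds_top, ⟨cfl80_need_kottwitz_top.2.2.2.2.2.2.1, cfl80_need_kottwitz_top.2.2.2.2.2.2.2.2.2.2⟩,
    ⟨cfl80_condC_denied_top.2.2.1, cfl80_condC_denied_top.2.2.2.1, cfl80_condC_denied_top.2.2.2.2.2⟩,
    fun l => ⟨(cfl_book_cm l).2.2.2, (cfl_book_cm l).2.1⟩, fun l => ⟨(cfl_mok_cm l).2.2.2.2.2.1, (cfl_mok_cm l).2.2.2.2.2.2⟩,
    fun l hl => ⟨(cfl_kmsw_cm l hl).2.2.2.2.2.2.1, (cfl_kmsw_cm l hl).2.2.2.2.2.2.2⟩⟩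

/-! ## 84. Eighty-first tranche (v4 of this file, after `Downstream22.lean` v1; unit `pub-arthur-down-g33`): supports of THE FORMAL DEGREE LINE — NEW row
B119 `ILMllcSO` / `ILMgeneric` / `ILMcor51` / `ILMnonsplit`, NEW row B120 `GVffLLC` (node) / `AKBformalDegreeFF`; see the module docstring for the summary. -/

section Canon81

variable (ν : Nodes)

/-- The parametrised canonical reading of the eighty-first tranche: `v` := the value given to tranche 57's node `LLCoddSO`, `b` := the value given to row B61's field `BPformalDegree`, `g` := the value of the Ganapathy – Varma node; the hypothesis field and Corollary 5.1 := the book's output at all ranks; the generic theorems := True; neither Mok's nor KMSW's nodes are read. [cite: IchinoLapidMao2017, §5, Cor. 5.1; AnanthaKrishna2026FDCFunctionFields, Thm 9.1 (canonical model; bookkeeping)] -/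
abbrev canon₈₁W (v b g : Prop) : Consumers81 where
  ILMllcSO := ∀ N, ν.Everything N
  ILMgeneric := True
  ILMcor51 := ∀ N, ν.Everything N
  ILMnonsplit := v ∧ ∀ N, ν.Everything N
  GVffLLC := g
  AKBformalDegreeFF := (∀ N, ν.Everything N) ∧ b ∧ g

/-- Every eighty-first-tranche edge holds in the parametrised reading, for arbitrary ν, for EVERY assignment of tranche 24's and tranche 57's fields and every value of the Ganapathy – Varma node. [cite: IchinoLapidMao2017, §5 with the proof of Cor. 5.1 (l.1235-1261); AnanthaKrishna2026FDCFunctionFields, §9 (l.1185-1228) (bookkeeping proved here)] -/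
theorem canon_implications₈₁W (c₂₄ : Consumers24) (c₅₇ : Consumers57) (g : Prop) :
    Implications81 ν c₂₄ c₅₇ (canon₈₁W ν c₅₇.LLCoddSO c₂₄.BPformalDegree g) where
  llcSO := fun b => b
  generic := trivial
  cor51 := fun h _ => h
  nonsplit := fun hv h => ⟨hv, h⟩
  akb := fun h hb hg => ⟨h, hb, hg⟩

/-- In the parametrised reading all six statements hold as soon as the book's outputs hold at all ranks, tranche 57's node and row B61's field hold, and the
Ganapathy – Varma node holds — through the tranche's own bookkeeping theorems `ilm81_of_book`, `ilmNonsplit_of_book_and_node`, `akb_of_rows`. [cite: IchinoLapidMao2017, Cor. 5.1; AnanthaKrishna2026FDCFunctionFields, Thm 9.1 (bookkeeping proved here)] -/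
theorem ilm81_all_of (c₂₄ : Consumers24) (c₅₇ : Consumers57) (g : Prop) (hν : ∀ N, ν.Everything N) (hv : c₅₇.LLCoddSO) (hb : c₂₄.BPformalDegree)
    (hg : g) : ((canon₈₁W ν c₅₇.LLCoddSO c₂₄.BPformalDegree g).ILMllcSO ∧ (canon₈₁W ν c₅₇.LLCoddSO c₂₄.BPformalDegree g).ILMgeneric ∧ (canon₈₁W ν c₅₇.LLCoddSO c₂₄.BPformalDegree g).ILMcor51 ∧ (canon₈₁W ν c₅₇.LLCoddSO c₂₄.BPformalDegree g).ILMnonsplit ∧ (canon₈₁W ν c₅₇.LLCoddSO c₂₄.BPformalDegree g).AKBformalDegreeFF) :=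
  have X := canon_implications₈₁W ν c₂₄ c₅₇ g
  have h3 := ilm81_of_book X hν
  ⟨h3.1, h3.2.1, h3.2.2, ilmNonsplit_of_book_and_node X hν hv, akb_of_rows X h3.2.2 hb hg⟩

end Canon81

/-- At the top (every input of the book's DAG; tranche 57's node and row B61's field read canonically — both derived there from the book's inputs —; the
Ganapathy – Varma node granted) all six statements of the tranche hold. [cite: IchinoLapidMao2017, Cor. 5.1; AnanthaKrishna2026FDCFunctionFields, Thm 9.1 (bookkeeping proved here)] -/
theorem eightyfirst_holds_top : ((canon₈₁W νtop (canon₅₇ νtop).LLCoddSO (canon₂₄ νtop μtop κtop).BPformalDegree True).ILMllcSO ∧ (canon₈₁W νtop (canon₅₇ νtop).LLCoddSO (canon₂₄ νtop μtop κtop).BPformalDegree True).ILMgeneric ∧ (canon₈₁W νtop (canon₅₇ νtop).LLCoddSO (canon₂₄ νtop μtop κtop).BPformalDegree True).ILMcor51 ∧ (canon₈₁W νtop (canon₅₇ νtop).LLCoddSO (canon₂₄ νtop μtop κtop).BPformalDegree True).ILMnonsplit ∧ (canon₈₁W νtop (canon₅₇ νtop).LLCoddSO (canon₂₄ νtop μtop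 κtop).BPformalDegree True).AKBformalDegreeFF) :=
  ilm81_all_of νtop (canon₂₄ νtop μtop κtop) (canon₅₇ νtop) True bookInputs_top.everything fiftyseventh_holds_top.1.1 twentyfourth_holds_top.2.1 trivial

/-- THE GANAPATHY – VARMA NODE IS LOAD-BEARING FOR B120 AND SUPPLIED BY NOTHING, AS TYPED: at the top — `BookInputs`, tranche 57's node and row B61's field granted —
the reading with the node DENIED satisfies every edge; all four statements of B119 hold; B120's Theorem 9.1 FAILS. [cite: AnanthaKrishna2026FDCFunctionFields, §9 (l.1192-1196: « in [GV17, Section 13.6] ») (separating model; bookkeeping proved here)] -/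
theorem akb81_need_gv_top :
    BookInputs νtop ∧ (canon₅₇ νtop).LLCoddSO ∧ (canon₂₄ νtop μtop κtop).BPformalDegree ∧
      Implications81 νtop (canon₂₄ νtop μtop κtop) (canon₅₇ νtop) (canon₈₁W νtop (canon₅₇ νtop).LLCoddSO (canon₂₄ νtop μtop κtop).BPformalDegree False) ∧
      ((canon₈₁W νtop (canon₅₇ νtop).LLCoddSO (canon₂₄ νtop μtop κtop).BPformalDegree False).ILMllcSO ∧ (canon₈₁W νtop (canon₅₇ νtop).LLCoddSO (canon₂₄ νtop μtop κtop).BPformalDegree False).ILMgeneric ∧ (canon₈₁W νtop (canon₅₇ νtop).LLCoddSO (canon₂₄ νtop μtop κtop).BPformalDegree False).ILMcor51) ∧ (canon₈₁W νtop (canon₅₇ νtop).LLCoddSO (canon₂₄ νtop μtop κtop).BPformalDegree False).ILMnonsplit ∧ ¬ (canon₈₁W νtop (canon₅₇ νtop).LLCoddSO (canon₂₄ νtop μtop κtop).BPformalDegree False).GVffLLC ∧ ¬ (canon₈₁W νtop (canon₅₇ νtop).LLCoddSO (canon₂₄ νtop μtop κtop).BPformalDegree False).AKBformalDegreeFF 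:=
  have hν : ∀ N, νtop.Everything N := bookInputs_top.everything
  have hv := fiftyseventh_holds_top.1.1
  ⟨bookInputs_top, hv, twentyfourth_holds_top.2.1, canon_implications₈₁W _ _ _ _, ⟨hν, trivial, hν⟩, ⟨hv, hν⟩, id, fun h => h.2.2⟩

/-- TRANCHE 57's NODE IS THE PREMISE OF THE NON-SPLIT STATEMENT, AS TYPED: at the top with the value of `LLCoddSO` DENIED in the reading (B61 and the Ganapathy – Varma
node granted) every edge holds, Corollary 5.1 and B120 hold, the non-split statement FAILS. [cite: IchinoLapidMao2017, §5 after Cor. 5.1 (l.1263-1302: « if we admit the local Langlands correspondence (cf. [WaldAst3472]) ») (separating model; bookkeeping proved here)] -/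
theorem ilmNonsplit81_need_node_top :
    Implications81 νtop (canon₂₄ νtop μtop κtop) ({ canon₅₇ νtop with LLCoddSO := False }) (canon₈₁W νtop False (canon₂₄ νtop μtop κtop).BPformalDegree True) ∧
      ((canon₈₁W νtop False (canon₂₄ νtop μtop κtop).BPformalDegree True).ILMllcSO ∧ (canon₈₁W νtop False (canon₂₄ νtop μtop κtop).BPformalDegree True).ILMgeneric ∧ (canon₈₁W νtop False (canon₂₄ νtop μtop κtop).BPformalDegree True).ILMcor51) ∧ (canon₈₁W νtop False (canon₂₄ νtop μtop κtop).BPformalDegree True).AKBformalDegreeFF ∧ ¬ (canon₈₁W νtop False (canon₂₄ νtop μtop κtop).BPformalDegree True).ILMnonsplit :=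
  have hν : ∀ N, νtop.Everything N := bookInputs_top.everything
  ⟨canon_implications₈₁W νtop (canon₂₄ νtop μtop κtop) { canon₅₇ νtop with LLCoddSO := False } True, ⟨hν, trivial, hν⟩,
    ⟨hν, twentyfourth_holds_top.2.1, trivial⟩, fun h => h.1⟩

/-- BOOK SIDE, EXACT SUPPORT AS TYPED — ALL 24 LEAVES: in the book countermodel of ANY leaf `l` (the book's edge systems and every other leaf hold, `l` fails; Mok and
KMSW at the top; tranches 57 and 24 read canonically over the countermodel; the Ganapathy – Varma node granted; every eighty-first edge valid) Corollary 5.1, the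
non-split statement and B120's Theorem 9.1 FAIL — the book premise the authors print (« under the local Langlands correspondence … established by Arthur ») is
load-bearing for each — while the generic Theorems 2.1 / 3.3 / 4.7 HOLD. [cite: IchinoLapidMao2017, §5 (l.1185-1186), Thms 2.1, 3.3, 4.7; AnanthaKrishna2026FDCFunctionFields, Thm 9.1, with Arthur2013 §1.5 (bookkeeping proved here)] -/
theorem ilm81_book_cm (l : LeafSupport.Leaf) :
    Implications81 (LeafSupport.mkN (LeafSupport.cm l)) (canon₂₄ (LeafSupport.mkN (LeafSupport.cm l)) μtop κtop) (canon₅₇ (LeafSupport.mkN (LeafSupport.cm l))) (canon₈₁W (LeafSupport.mkN (LeafSupport.cm l)) (canon₅₇ (LeafSupport.mkN (LeafSupport.cm l))).LLCoddSO (canon₂₄ (LeafSupport.mkN (LeafSupport.cm l)) μtop κtop).BPformalDegree True) ∧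
      (∀ l', l' ≠ l → (LeafSupport.mkN (LeafSupport.cm l)).leaf l') ∧ ¬ (LeafSupport.mkN (LeafSupport.cm l)).leaf l ∧
      (canon₈₁W (LeafSupport.mkN (LeafSupport.cm l)) (canon₅₇ (LeafSupport.mkN (LeafSupport.cm l))).LLCoddSO (canon₂₄ (LeafSupport.mkN (LeafSupport.cm l)) μtop κtop).BPformalDegree True).ILMgeneric ∧ ¬ (canon₈₁W (LeafSupport.mkN (LeafSupport.cm l)) (canon₅₇ (LeafSupport.mkN (LeafSupport.cm l))).LLCoddSO (canon₂₄ (LeafSupport.mkN (LeafSupport.cm l)) μtop κtop).BPformalDegree True).ILMcor51 ∧ ¬ (canon₈₁W (LeafSupport.mkN (LeafSupport.cm l)) (canon₅₇ (LeafSupport.mkN (LeafSupport.cm l))).LLCoddSO (canon₂₄ (LeafSupport.mkN (LeafSupport.cm l)) μtop κtop).BPformalDegree True).ILMnonsplit ∧ ¬ (canon₈₁W (LeafSupport.mkN (LeafSupport.cm l)) (canon₅₇ (LeafSupport.mkN (LeafSupport.cm l))).LLCoddSO (canon₂₄ (LeafSupport.mkN (LeafSupport.cm l)) μtop κtop).BPformalDegree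 True).AKBformalDegreeFF :=
  have cmod := LeafSupport.countermodel l
  have nb := not_B_cm l
  ⟨canon_implications₈₁W _ _ _ _, cmod.2.1, cmod.2.2.1, trivial, nb, fun h => nb h.2, fun h => nb h.1⟩

/-- MOK AND KMSW SIDES, EXACT SUPPORT AS TYPED — NOTHING: with the book at the top, Mok read by the countermodel of ANY of its leaves and KMSW WITHOUT its Mok import
(`κnoMok`), tranche 24 read canonically over these (row B61's canonical value reads book nodes only), tranche 57's node and the Ganapathy – Varma node granted,
all six statements HOLD — no premise of the tranche reads Mok or KMSW; neither paper cites them. [cite: IchinoLapidMao2017, bibliography (no [Mok15] / [KMSW] entry); AnanthaKrishna2026FDCFunctionFields, bibliography (bookkeeping proved here)] -/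
theorem ilm81_mok_kmsw_free (l : Mok2015.LeafSupport.Leaf) :
    ¬ (Mok2015.LeafSupport.mkN (Mok2015.LeafSupport.cm l)).leaf l ∧ Implications81 νtop (canon₂₄ νtop (Mok2015.LeafSupport.mkN (Mok2015.LeafSupport.cm l)) κnoMok) (canon₅₇ νtop) (canon₈₁W νtop (canon₅₇ νtop).LLCoddSO (canon₂₄ νtop (Mok2015.LeafSupport.mkN (Mok2015.LeafSupport.cm l)) κnoMok).BPformalDegree True) ∧ ((canon₈₁W νtop (canon₅₇ νtop).LLCoddSO (canon₂₄ νtop (Mok2015.LeafSupport.mkN (Mok2015.LeafSupport.cm l)) κnoMok).BPformalDegree True).ILMllcSO ∧ (canon₈₁W νtop (canon₅₇ νtop).LLCoddSO (canon₂₄ νtop (Mok2015.LeafSupport.mkN (Mok2015.LeafSupport.cm l)) κnoMok).BPformalDegree True).ILMgeneric ∧ (canon₈₁W νtop (canon₅₇ νtop).LLCoddSO (canon₂₄ νtop (Mok2015.LeafSupport.mkN (Mok2015.LeafSupport.cm l)) κnoMok).BPformalDegree True).ILMcor51 ∧ (canon₈₁W νtop (canon₅₇ νtop).LLCoddSO (canon₂₄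 νtop (Mok2015.LeafSupport.mkN (Mok2015.LeafSupport.cm l)) κnoMok).BPformalDegree True).ILMnonsplit ∧ (canon₈₁W νtop (canon₅₇ νtop).LLCoddSO (canon₂₄ νtop (Mok2015.LeafSupport.mkN (Mok2015.LeafSupport.cm l)) κnoMok).BPformalDegree True).AKBformalDegreeFF) :=
  have cmod := Mok2015.LeafSupport.countermodel l
  have hb : (canon₂₄ νtop (Mok2015.LeafSupport.mkN (Mok2015.LeafSupport.cm l)) κnoMok).BPformalDegree := twentyfourth_holds_top.2.1
  ⟨cmod.2.2.1, canon_implications₈₁W _ _ _ _,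
    ilm81_all_of νtop (canon₂₄ νtop (Mok2015.LeafSupport.mkN (Mok2015.LeafSupport.cm l)) κnoMok) (canon₅₇ νtop) True bookInputs_top.everything fiftyseventh_holds_top.1.1 hb trivial⟩

/-- THE EIGHTY-FIRST TRANCHE REGRADED, in one statement: (i) at the top all six hold; (ii) Ganapathy – Varma node denied at the top: B120 fails, every edge valid;
(iii) tranche 57's node denied at the top: the non-split statement fails, Corollary 5.1 holds; (iv) in the book countermodel of any leaf the three conditional
statements fail and the generic theorems hold; (v) for every Mok countermodel (KMSW without Mok) all six hold. [cite: IchinoLapidMao2017, Cor. 5.1, §5; AnanthaKrishna2026FDCFunctionFields, Thm 9.1 (bookkeeping proved here)] -/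
theorem ilm81_regraded :
    ((canon₈₁W νtop (canon₅₇ νtop).LLCoddSO (canon₂₄ νtop μtop κtop).BPformalDegree True).ILMllcSO ∧ (canon₈₁W νtop (canon₅₇ νtop).LLCoddSO (canon₂₄ νtop μtop κtop).BPformalDegree True).ILMgeneric ∧ (canon₈₁W νtop (canon₅₇ νtop).LLCoddSO (canon₂₄ νtop μtop κtop).BPformalDegree True).ILMcor51 ∧ (canon₈₁W νtop (canon₅₇ νtop).LLCoddSO (canon₂₄ νtop μtop κtop).BPformalDegree True).ILMnonsplit ∧ (canon₈₁W νtop (canon₅₇ νtop).LLCoddSO (canon₂₄ νtop μtop κtop).BPformalDegree True).AKBformalDegreeFF) ∧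
      (Implications81 νtop (canon₂₄ νtop μtop κtop) (canon₅₇ νtop) (canon₈₁W νtop (canon₅₇ νtop).LLCoddSO (canon₂₄ νtop μtop κtop).BPformalDegree False) ∧ ¬ (canon₈₁W νtop (canon₅₇ νtop).LLCoddSO (canon₂₄ νtop μtop κtop).BPformalDegree False).AKBformalDegreeFF ∧ (canon₈₁W νtop (canon₅₇ νtop).LLCoddSO (canon₂₄ νtop μtop κtop).BPformalDegree False).ILMcor51) ∧
      (¬ (canon₈₁W νtop False (canon₂₄ νtop μtop κtop).BPformalDegree True).ILMnonsplit ∧ (canon₈₁W νtop False (canon₂₄ νtop μtop κtop).BPformalDegree True).ILMcor51) ∧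
      (∀ l : LeafSupport.Leaf, (¬ (LeafSupport.mkN (LeafSupport.cm l)).leaf l) ∧ (canon₈₁W (LeafSupport.mkN (LeafSupport.cm l)) (canon₅₇ (LeafSupport.mkN (LeafSupport.cm l))).LLCoddSO (canon₂₄ (LeafSupport.mkN (LeafSupport.cm l)) μtop κtop).BPformalDegree True).ILMgeneric ∧ ¬ (canon₈₁W (LeafSupport.mkN (LeafSupport.cm l)) (canon₅₇ (LeafSupport.mkN (LeafSupport.cm l))).LLCoddSO (canon₂₄ (LeafSupport.mkN (LeafSupport.cm l)) μtop κtop).BPformalDegree True).ILMcor51 ∧ ¬ (canon₈₁W (LeafSupport.mkN (LeafSupport.cm l)) (canon₅₇ (LeafSupport.mkN (LeafSupport.cm l))).LLCoddSO (canon₂₄ (LeafSupport.mkN (LeafSupport.cm l)) μtop κtop).BPformalDegree True).ILMnonsplit ∧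
        ¬ (canon₈₁W (LeafSupport.mkN (LeafSupport.cm l)) (canon₅₇ (LeafSupport.mkN (LeafSupport.cm l))).LLCoddSO (canon₂₄ (LeafSupport.mkN (LeafSupport.cm l)) μtop κtop).BPformalDegree True).AKBformalDegreeFF) ∧
      (∀ l : Mok2015.LeafSupport.Leaf, (¬ (Mok2015.LeafSupport.mkN (Mok2015.LeafSupport.cm l)).leaf l) ∧ ((canon₈₁W νtop (canon₅₇ νtop).LLCoddSO (canon₂₄ νtop (Mok2015.LeafSupport.mkN (Mok2015.LeafSupport.cm l)) κnoMok).BPformalDegree True).ILMllcSO ∧ (canon₈₁W νtop (canon₅₇ νtop).LLCoddSO (canon₂₄ νtop (Mok2015.LeafSupport.mkN (Mok2015.LeafSupport.cm l)) κnoMok).BPformalDegree True).ILMgeneric ∧ (canon₈₁W νtop (canon₅₇ νtop).LLCoddSO (canon₂₄ νtop (Mok2015.LeafSupport.mkN (Mok2015.LeafSupport.cm l)) κnoMok).BPformalDegree True).ILMcor51 ∧ (canon₈₁W νtop (canon₅₇ νtop).LLCoddSO (canon₂₄ νtop (Mok2015.LeafSupport.mkN (Mok2015.LeafSupport.cm l))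 κnoMok).BPformalDegree True).ILMnonsplit ∧ (canon₈₁W νtop (canon₅₇ νtop).LLCoddSO (canon₂₄ νtop (Mok2015.LeafSupport.mkN (Mok2015.LeafSupport.cm l)) κnoMok).BPformalDegree True).AKBformalDegreeFF)) :=
  ⟨eightyfirst_holds_top, ⟨akb81_need_gv_top.2.2.2.1, akb81_need_gv_top.2.2.2.2.2.2.2, akb81_need_gv_top.2.2.2.2.1.2.2⟩,
    ⟨ilmNonsplit81_need_node_top.2.2.2, ilmNonsplit81_need_node_top.2.1.2.2⟩,
    fun l => ⟨(ilm81_book_cm l).2.2.1, (ilm81_book_cm l).2.2.2.1, (ilm81_book_cm l).2.2.2.2.1, (ilm81_book_cm l).2.2.2.2.2.1, (ilm81_book_cm l).2.2.2.2.2.2⟩,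
    fun l => ⟨(ilm81_mok_kmsw_free l).1, (ilm81_mok_kmsw_free l).2.2⟩⟩

/-! ## 85. Eighty-second tranche (v5 of this file, after `Downstream22.lean` v2; unit `pub-arthur-down-g33`): supports of MR-NUMBER CITERS OF THE BOOK, II —
NEW rows C206 `BGWchar0` / `BGWthmD` / `BGWthmB` / `BGWezc`, C207 `XZgalois` / `XZRT` / `XZBK`, C208 `BPweakRegLGC`, C209 `ELstableTempered` / `ELmain`; see the
module docstring for the summary. -/

section Canon82

variable (ν : Nodes) (μ : Mok2015.Nodes)

/-- The parametrised canonical reading of the eighty-second tranche: `w` := the value of Shin's `WeakS ∧ GalRepGLN` (row E1), `t` := row A3's `TaibiInner`, `gt` := row A4's `GeeTaibi`, `fp` := row C141's `FPWeaklyRegular`; the book-citing statements := the book's output at all ranks (conjoined with their row premises); Theorem B := True; C208 := Mok's output ∧ fp; KMSW's nodes are not read. [cite: BarreraGrahamWilliams2025LGCEZC, Thm D; XZhang2024TaylorWilesOrthogonal, Thms 1.1, 2.3; BoxerPilloni2021HigherColeman, §6.11; EnnsLee2024ModpLGCGSp4, Thm 4.5.1 (canonical model; bookkeeping)] -/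
abbrev canon₈₂W (w t gt fp : Prop) : Consumers82 where
  BGWchar0 := ∀ N, ν.Everything N
  BGWthmD := ∀ N, ν.Everything N
  BGWthmB := True
  BGWezc := ∀ N, ν.Everything N
  XZgalois := w
  XZRT := w
  XZBK := w ∧ t ∧ ∀ N, ν.Everything N
  BPweakRegLGC := (∀ N, μ.Everything N) ∧ fp
  ELstableTempered := (∀ N, ν.Everything N) ∧ gt ∧ t
  ELmain := (∀ N, ν.Everything N) ∧ gt ∧ t

/-- Every eighty-second-tranche edge holds in the parametrised reading, for arbitrary ν, μ, for EVERY assignment of the first tranche's fields, of Shin's statements and of tranche 74's fields. [cite: BarreraGrahamWilliams2025LGCEZC, §9; XZhang2024TaylorWilesOrthogonal, §2, §7; BoxerPilloni2021HigherColeman, §6.11; EnnsLee2024ModpLGCGSp4, §4.1 (bookkeeping proved here)] -/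
theorem canon_implications₈₂W (c : Consumers) (s : Shin) (c₇₄ : Consumers74) :
    Implications82 ν μ c s c₇₄ (canon₈₂W ν μ (s.WeakS ∧ s.GalRepGLN) c.TaibiInner c.GeeTaibi c₇₄.FPWeaklyRegular) where
  bgwChar0 := fun h => h
  bgwThmD := fun _ h => h
  bgwThmB := trivial
  bgwEzc := fun h => h
  xzGalois := fun hw hg => ⟨hw, hg⟩
  xzRT := fun h => h
  xzBK := fun h ht hν => ⟨h, ht, hν⟩
  bp := fun hμ hf => ⟨hμ, hf⟩
  el := fun hν hg ht => ⟨hν, hg, ht⟩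
  elMain := fun h => h

/-- In the parametrised reading all ten statements hold as soon as the book's and Mok's outputs hold at all ranks and the four row premises hold — through the
tranche's own bookkeeping theorems `bgw_of_book`, `xz_of_rows`, `bp_of_mok_and_row`, `el_of_rows`. [cite: BarreraGrahamWilliams2025LGCEZC, Thms A–D; XZhang2024TaylorWilesOrthogonal, Thms 1.1, 1.5, 2.3, 2.6; BoxerPilloni2021HigherColeman, §6.11; EnnsLee2024ModpLGCGSp4, Thm 4.5.1 (bookkeeping proved here)] -/
theorem c82_all_of (c : Consumers) (s : Shin) (c₇₄ : Consumers74) (hν : ∀ N, ν.Everything N) (hμ : ∀ N, μ.Everything N) (hW : s.WeakS) (hG : s.GalRepGLN)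
    (hT : c.TaibiInner) (hGT : c.GeeTaibi) (hFP : c₇₄.FPWeaklyRegular) :
    (((canon₈₂W ν μ (s.WeakS ∧ s.GalRepGLN) c.TaibiInner c.GeeTaibi c₇₄.FPWeaklyRegular).BGWchar0 ∧ (canon₈₂W ν μ (s.WeakS ∧ s.GalRepGLN) c.TaibiInner c.GeeTaibi c₇₄.FPWeaklyRegular).BGWthmD ∧ (canon₈₂W ν μ (s.WeakS ∧ s.GalRepGLN) c.TaibiInner c.GeeTaibi c₇₄.FPWeaklyRegular).BGWthmB ∧ (canon₈₂W ν μ (s.WeakS ∧ s.GalRepGLN) c.TaibiInner c.GeeTaibi c₇₄.FPWeaklyRegular).BGWezc ∧ (canon₈₂W ν μ (s.WeakS ∧ s.GalRepGLN) c.TaibiInner c.GeeTaibi c₇₄.FPWeaklyRegular).XZgalois ∧ (canon₈₂W ν μ (s.WeakS ∧ s.GalRepGLN) c.TaibiInner c.GeeTaibi c₇₄.FPWeaklyRegular).XZRT ∧ (canon₈₂W ν μ (s.WeakS ∧ s.GalRepGLN) c.TaibiInner c.GeeTaibi c₇₄.FPWeaklyRegular).XZBK ∧ (canon₈₂W ν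 μ (s.WeakS ∧ s.GalRepGLN) c.TaibiInner c.GeeTaibi c₇₄.FPWeaklyRegular).ELstableTempered ∧ (canon₈₂W ν μ (s.WeakS ∧ s.GalRepGLN) c.TaibiInner c.GeeTaibi c₇₄.FPWeaklyRegular).ELmain) ∧ (canon₈₂W ν μ (s.WeakS ∧ s.GalRepGLN) c.TaibiInner c.GeeTaibi c₇₄.FPWeaklyRegular).BPweakRegLGC) :=
  have X := canon_implications₈₂W ν μ c s c₇₄
  have hB := bgw_of_book X hν
  have hX := xz_of_rows X hW hG hT hν
  have hE := el_of_rows X hν hGT hT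
  ⟨⟨hB.1, hB.2.1, hB.2.2.1, hB.2.2.2, hX.1, hX.2.1, hX.2.2, hE.1, hE.2⟩, bp_of_mok_and_row X hμ hFP⟩

end Canon82

/-- Shin's canonical weak transfer (row E1's `canonShin`, Case S) HOLDS at the top of the book's DAG — evaluated on the carver's numerals by `weakS_mk`. [cite: Shin2024, Thm 1.1.2 (canonical model; bookkeeping proved here)] -/
theorem shinWeakS_top : (canonShin νtop μtop κtop).WeakS :=
  (weakS_mk _ μtop κtop).2 (by decide)

/-- At the top (every input of the three DAGs; tranches 1 and 74 and Shin read canonically) all ten statements of the tranche hold. [cite: BarreraGrahamWilliams2025LGCEZC, Thms A–D; XZhang2024TaylorWilesOrthogonal, Thm 1.1; BoxerPilloni2021HigherColeman, §6.11; EnnsLee2024ModpLGCGSp4, Thm 4.5.1 (bookkeeping proved here)] -/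
theorem eightysecond_holds_top : (((canon₈₂W νtop μtop ((canonShin νtop μtop κtop).WeakS ∧ (canonShin νtop μtop κtop).GalRepGLN) (canon νtop μtop κtop).TaibiInner (canon νtop μtop κtop).GeeTaibi (canon₇₄ νtop μtop κtop).FPWeaklyRegular).BGWchar0 ∧ (canon₈₂W νtop μtop ((canonShin νtop μtop κtop).WeakS ∧ (canonShin νtop μtop κtop).GalRepGLN) (canon νtop μtop κtop).TaibiInner (canon νtop μtop κtop).GeeTaibi (canon₇₄ νtop μtop κtop).FPWeaklyRegular).BGWthmD ∧ (canon₈₂W νtop μtop ((canonShin νtop μtop κtop).WeakS ∧ (canonShin νtop μtop κtop).GalRepGLN) (canon νtop μtop κtop).TaibiInner (canon νtop μtop κtop).GeeTaibi (canon₇₄ νtop μtop κtop).FPWeaklyRegular).BGWthmB ∧ (canon₈₂W νtop μtop ((canonShin νtop μtop κtop).WeakS ∧ (canonShin νtop μtop κtop).GalRepGLN) (canon νtop μtop κtop).TaibiInner (canon νtop μtop κtop).GeeTaibi (canon₇₄ νtop μtop κtop).FPWeaklyRegular).BGWezc ∧ (canon₈₂W νtop μtop ((canonShin νtop μtop κtop).WeakS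 ∧ (canonShin νtop μtop κtop).GalRepGLN) (canon νtop μtop κtop).TaibiInner (canon νtop μtop κtop).GeeTaibi (canon₇₄ νtop μtop κtop).FPWeaklyRegular).XZgalois ∧ (canon₈₂W νtop μtop ((canonShin νtop μtop κtop).WeakS ∧ (canonShin νtop μtop κtop).GalRepGLN) (canon νtop μtop κtop).TaibiInner (canon νtop μtop κtop).GeeTaibi (canon₇₄ νtop μtop κtop).FPWeaklyRegular).XZRT ∧ (canon₈₂W νtop μtop ((canonShin νtop μtop κtop).WeakS ∧ (canonShin νtop μtop κtop).GalRepGLN) (canon νtop μtop κtop).TaibiInner (canon νtop μtop κtop).GeeTaibi (canon₇₄ νtop μtop κtop).FPWeaklyRegular).XZBK ∧ (canon₈₂W νtop μtop ((canonShin νtop μtop κtop).WeakS ∧ (canonShin νtop μtop κtop).GalRepGLN) (canon νtop μtop κtop).TaibiInner (canon νtop μtop κtop).GeeTaibi (canon₇₄ νtop μtop κtop).FPWeaklyRegular).ELstableTempered ∧ (canon₈₂W νtop μtop ((canonShin νtop μtop κtop).WeakS ∧ (canonShin νtop μtop κtop).GalRepGLN) (canon νtop μtop κtop).TaibiInner (canon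 νtop μtop κtop).GeeTaibi (canon₇₄ νtop μtop κtop).FPWeaklyRegular).ELmain) ∧ (canon₈₂W νtop μtop ((canonShin νtop μtop κtop).WeakS ∧ (canonShin νtop μtop κtop).GalRepGLN) (canon νtop μtop κtop).TaibiInner (canon νtop μtop κtop).GeeTaibi (canon₇₄ νtop μtop κtop).FPWeaklyRegular).BPweakRegLGC) :=
  have b : ∀ N, νtop.Everything N := bookInputs_top.everything
  have m : ∀ N, μtop.Everything N := mokInputs_top.everything
  c82_all_of νtop μtop (canon νtop μtop κtop) (canonShin νtop μtop κtop) (canon₇₄ νtop μtop κtop) b m shinWeakS_top trivial b b m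

/-- BOOK SIDE, EXACT SUPPORT AS TYPED: in the book countermodel of ANY leaf `l` (the book's edge systems and every other leaf hold, `l` fails; Mok and KMSW at the top;
tranches 1, 74 and Shin read canonically over the countermodel; every eighty-second edge valid) the three book-citing statements of C206, C207's Bloch – Kato theorems
and both statements of C209 FAIL; C206's Theorem B and C208's theorem HOLD; and C207's Galois representations / R ≃ 𝕋 hold IFF `l` is outside the nine leaves of Shin's
weak transfer. [cite: BarreraGrahamWilliams2025LGCEZC, Thm D with Remark l.459-461; XZhang2024TaylorWilesOrthogonal, Thms 1.1, 2.3 (proof l.995-997); BoxerPilloni2021HigherColeman, §6.11; EnnsLee2024ModpLGCGSp4, §4.1; Shin2024, (H1) (bookkeeping proved here)] -/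
theorem c82_book_cm (l : LeafSupport.Leaf) :
    Implications82 (LeafSupport.mkN (LeafSupport.cm l)) μtop (canon (LeafSupport.mkN (LeafSupport.cm l)) μtop κtop) (canonShin (LeafSupport.mkN (LeafSupport.cm l)) μtop κtop) (canon₇₄ (LeafSupport.mkN (LeafSupport.cm l)) μtop κtop) (canon₈₂W (LeafSupport.mkN (LeafSupport.cm l)) μtop ((canonShin (LeafSupport.mkN (LeafSupport.cm l)) μtop κtop).WeakS ∧ (canonShin (LeafSupport.mkN (LeafSupport.cm l)) μtop κtop).GalRepGLN) (canon (LeafSupport.mkN (LeafSupport.cm l)) μtop κtop).TaibiInner (canon (LeafSupport.mkN (LeafSupport.cm l)) μtop κtop).GeeTaibi (canon₇₄ (LeafSupport.mkN (LeafSupport.cm l)) μtop κtop).FPWeaklyRegular) ∧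
      (∀ l', l' ≠ l → (LeafSupport.mkN (LeafSupport.cm l)).leaf l') ∧ ¬ (LeafSupport.mkN (LeafSupport.cm l)).leaf l ∧
      ¬ (canon₈₂W (LeafSupport.mkN (LeafSupport.cm l)) μtop ((canonShin (LeafSupport.mkN (LeafSupport.cm l)) μtop κtop).WeakS ∧ (canonShin (LeafSupport.mkN (LeafSupport.cm l)) μtop κtop).GalRepGLN) (canon (LeafSupport.mkN (LeafSupport.cm l)) μtop κtop).TaibiInner (canon (LeafSupport.mkN (LeafSupport.cm l)) μtop κtop).GeeTaibi (canon₇₄ (LeafSupport.mkN (LeafSupport.cm l)) μtop κtop).FPWeaklyRegular).BGWchar0 ∧ ¬ (canon₈₂W (LeafSupport.mkN (LeafSupport.cm l)) μtop ((canonShin (LeafSupport.mkN (LeafSupport.cm l)) μtop κtop).WeakS ∧ (canonShin (LeafSupport.mkN (LeafSupport.cm l)) μtop κtop).GalRepGLN) (canon (LeafSupport.mkN (LeafSupport.cm l)) μtop κtop).TaibiInner (canon (LeafSupport.mkN (LeafSupport.cm l)) μtop κtop).GeeTaibi (canon₇₄ (LeafSupport.mkN (LeafSupport.cm l)) μtop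 κtop).FPWeaklyRegular).BGWthmD ∧ (canon₈₂W (LeafSupport.mkN (LeafSupport.cm l)) μtop ((canonShin (LeafSupport.mkN (LeafSupport.cm l)) μtop κtop).WeakS ∧ (canonShin (LeafSupport.mkN (LeafSupport.cm l)) μtop κtop).GalRepGLN) (canon (LeafSupport.mkN (LeafSupport.cm l)) μtop κtop).TaibiInner (canon (LeafSupport.mkN (LeafSupport.cm l)) μtop κtop).GeeTaibi (canon₇₄ (LeafSupport.mkN (LeafSupport.cm l)) μtop κtop).FPWeaklyRegular).BGWthmB ∧ ¬ (canon₈₂W (LeafSupport.mkN (LeafSupport.cm l)) μtop ((canonShin (LeafSupport.mkN (LeafSupport.cm l)) μtop κtop).WeakS ∧ (canonShin (LeafSupport.mkN (LeafSupport.cm l)) μtop κtop).GalRepGLN) (canon (LeafSupport.mkN (LeafSupport.cm l)) μtop κtop).TaibiInner (canon (LeafSupport.mkN (LeafSupport.cm l)) μtop κtop).GeeTaibi (canon₇₄ (LeafSupport.mkN (LeafSupport.cm l)) μtop κtop).FPWeaklyRegular).BGWezc ∧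
      ((canon₈₂W (LeafSupport.mkN (LeafSupport.cm l)) μtop ((canonShin (LeafSupport.mkN (LeafSupport.cm l)) μtop κtop).WeakS ∧ (canonShin (LeafSupport.mkN (LeafSupport.cm l)) μtop κtop).GalRepGLN) (canon (LeafSupport.mkN (LeafSupport.cm l)) μtop κtop).TaibiInner (canon (LeafSupport.mkN (LeafSupport.cm l)) μtop κtop).GeeTaibi (canon₇₄ (LeafSupport.mkN (LeafSupport.cm l)) μtop κtop).FPWeaklyRegular).XZRT ↔ l.shinS = false) ∧ ¬ (canon₈₂W (LeafSupport.mkN (LeafSupport.cm l)) μtop ((canonShin (LeafSupport.mkN (LeafSupport.cm l)) μtop κtop).WeakS ∧ (canonShin (LeafSupport.mkN (LeafSupport.cm l)) μtop κtop).GalRepGLN) (canon (LeafSupport.mkN (LeafSupport.cm l)) μtop κtop).TaibiInner (canon (LeafSupport.mkN (LeafSupport.cm l)) μtop κtop).GeeTaibi (canon₇₄ (LeafSupport.mkN (LeafSupport.cm l)) μtop κtop).FPWeaklyRegular).XZBK ∧ (canon₈₂W (LeafSupport.mkN (LeafSupport.cm l)) μtop ((canonShin (LeafSupport.mkN (LeafSupport.cm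 l)) μtop κtop).WeakS ∧ (canonShin (LeafSupport.mkN (LeafSupport.cm l)) μtop κtop).GalRepGLN) (canon (LeafSupport.mkN (LeafSupport.cm l)) μtop κtop).TaibiInner (canon (LeafSupport.mkN (LeafSupport.cm l)) μtop κtop).GeeTaibi (canon₇₄ (LeafSupport.mkN (LeafSupport.cm l)) μtop κtop).FPWeaklyRegular).BPweakRegLGC ∧
      ¬ (canon₈₂W (LeafSupport.mkN (LeafSupport.cm l)) μtop ((canonShin (LeafSupport.mkN (LeafSupport.cm l)) μtop κtop).WeakS ∧ (canonShin (LeafSupport.mkN (LeafSupport.cm l)) μtop κtop).GalRepGLN) (canon (LeafSupport.mkN (LeafSupport.cm l)) μtop κtop).TaibiInner (canon (LeafSupport.mkN (LeafSupport.cm l)) μtop κtop).GeeTaibi (canon₇₄ (LeafSupport.mkN (LeafSupport.cm l)) μtop κtop).FPWeaklyRegular).ELstableTempered ∧ ¬ (canon₈₂W (LeafSupport.mkN (LeafSupport.cm l)) μtop ((canonShin (LeafSupport.mkN (LeafSupport.cm l)) μtop κtop).WeakS ∧ (canonShin (LeafSupport.mkN (LeafSupport.cm l)) μtop κtop).GalRepGLN)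 (canon (LeafSupport.mkN (LeafSupport.cm l)) μtop κtop).TaibiInner (canon (LeafSupport.mkN (LeafSupport.cm l)) μtop κtop).GeeTaibi (canon₇₄ (LeafSupport.mkN (LeafSupport.cm l)) μtop κtop).FPWeaklyRegular).ELmain :=
  have cmod := LeafSupport.countermodel l
  have nb := not_B_cm l
  have m : ∀ N, μtop.Everything N := mokInputs_top.everything
  have hs := shin_weakS_support l
  ⟨canon_implications₈₂W _ _ _ _ _, cmod.2.1, cmod.2.2.1, nb, nb, trivial, nb,
    ⟨fun h => hs.1 h.1, fun h => ⟨hs.2 h, trivial⟩⟩, fun h => nb h.2.2, ⟨m, m⟩, fun h => nb h.1, fun h => nb h.1⟩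

/-- C207's R ≃ 𝕋, TWO-SIDED SUPPORT in the 24 book models (canonical reading through row E1): it FAILS exactly when the removed leaf is one of the nine leaves of Shin's
weak transfer (FL, WFL_split, W4_Thm38, STF_Arthur, TwistedTF, MW_Stab, SpecGLN, WFL_general, WFL_nonstandard) and HOLDS for the other fifteen — in particular for
every leaf of the book's own derivations and of the 2024–2026 preprint layer; the two unwritten weighted fundamental lemmas the author's proof of Theorem 2.3 calls
« already proved » are IN the support. [cite: XZhang2024TaylorWilesOrthogonal, Thm 1.1, proof of Thm 2.3 (l.995-997); Shin2024, (H1) p0006:L5 (bookkeeping proved here: two-sided support)] -/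
theorem xzRT82_support (l : LeafSupport.Leaf) : ((canon₈₂W (LeafSupport.mkN (LeafSupport.cm l)) μtop ((canonShin (LeafSupport.mkN (LeafSupport.cm l)) μtop κtop).WeakS ∧ (canonShin (LeafSupport.mkN (LeafSupport.cm l)) μtop κtop).GalRepGLN) (canon (LeafSupport.mkN (LeafSupport.cm l)) μtop κtop).TaibiInner (canon (LeafSupport.mkN (LeafSupport.cm l)) μtop κtop).GeeTaibi (canon₇₄ (LeafSupport.mkN (LeafSupport.cm l)) μtop κtop).FPWeaklyRegular).XZRT ↔ l.shinS = false) :=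
  (c82_book_cm l).2.2.2.2.2.2.2.1

/-- MOK SIDE, EXACT SUPPORT AS TYPED: with the book at the top, Mok read by the countermodel of ANY of its leaves and KMSW WITHOUT its Mok import (`κnoMok`), tranches
1, 74 and Shin read canonically over these, every eighty-second edge valid: C208's theorem FAILS (Mok load-bearing through the descent and through row C141) and the
nine book-side statements HOLD (no premise of C206, C207, C209 reads Mok or KMSW). [cite: BoxerPilloni2021HigherColeman, §1.4 Remark (l.362), §6.11 (l.5451); BarreraGrahamWilliams2025LGCEZC, bibliography; XZhang2024TaylorWilesOrthogonal, bibliography; EnnsLee2024ModpLGCGSp4, references (bookkeeping proved here)] -/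
theorem c82_mok_cm (l : Mok2015.LeafSupport.Leaf) :
    ¬ (Mok2015.LeafSupport.mkN (Mok2015.LeafSupport.cm l)).leaf l ∧ Implications82 νtop (Mok2015.LeafSupport.mkN (Mok2015.LeafSupport.cm l)) (canon νtop (Mok2015.LeafSupport.mkN (Mok2015.LeafSupport.cm l)) κnoMok) (canonShin νtop (Mok2015.LeafSupport.mkN (Mok2015.LeafSupport.cm l)) κnoMok) (canon₇₄ νtop (Mok2015.LeafSupport.mkN (Mok2015.LeafSupport.cm l)) κnoMok) (canon₈₂W νtop (Mok2015.LeafSupport.mkN (Mok2015.LeafSupport.cm l)) ((canonShin νtop (Mok2015.LeafSupport.mkN (Mok2015.LeafSupport.cm l)) κnoMok).WeakS ∧ (canonShin νtop (Mok2015.LeafSupport.mkN (Mok2015.LeafSupport.cm l)) κnoMok).GalRepGLN) (canon νtop (Mok2015.LeafSupport.mkN (Mok2015.LeafSupport.cm l)) κnoMok).TaibiInner (canon νtop (Mok2015.LeafSupport.mkN (Mok2015.LeafSupport.cm l)) κnoMok).GeeTaibi (canon₇₄ νtop (Mok2015.LeafSupport.mkN (Mok2015.LeafSupport.cm l)) κnoMok).FPWeaklyRegular)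 ∧
      ((canon₈₂W νtop (Mok2015.LeafSupport.mkN (Mok2015.LeafSupport.cm l)) ((canonShin νtop (Mok2015.LeafSupport.mkN (Mok2015.LeafSupport.cm l)) κnoMok).WeakS ∧ (canonShin νtop (Mok2015.LeafSupport.mkN (Mok2015.LeafSupport.cm l)) κnoMok).GalRepGLN) (canon νtop (Mok2015.LeafSupport.mkN (Mok2015.LeafSupport.cm l)) κnoMok).TaibiInner (canon νtop (Mok2015.LeafSupport.mkN (Mok2015.LeafSupport.cm l)) κnoMok).GeeTaibi (canon₇₄ νtop (Mok2015.LeafSupport.mkN (Mok2015.LeafSupport.cm l)) κnoMok).FPWeaklyRegular).BGWchar0 ∧ (canon₈₂W νtop (Mok2015.LeafSupport.mkN (Mok2015.LeafSupport.cm l)) ((canonShin νtop (Mok2015.LeafSupport.mkN (Mok2015.LeafSupport.cm l)) κnoMok).WeakS ∧ (canonShin νtop (Mok2015.LeafSupport.mkN (Mok2015.LeafSupport.cm l)) κnoMok).GalRepGLN) (canon νtop (Mok2015.LeafSupport.mkN (Mok2015.LeafSupport.cm l)) κnoMok).TaibiInner (canon νtop (Mok2015.LeafSupport.mkN (Mok2015.LeafSupport.cm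 l)) κnoMok).GeeTaibi (canon₇₄ νtop (Mok2015.LeafSupport.mkN (Mok2015.LeafSupport.cm l)) κnoMok).FPWeaklyRegular).BGWthmD ∧ (canon₈₂W νtop (Mok2015.LeafSupport.mkN (Mok2015.LeafSupport.cm l)) ((canonShin νtop (Mok2015.LeafSupport.mkN (Mok2015.LeafSupport.cm l)) κnoMok).WeakS ∧ (canonShin νtop (Mok2015.LeafSupport.mkN (Mok2015.LeafSupport.cm l)) κnoMok).GalRepGLN) (canon νtop (Mok2015.LeafSupport.mkN (Mok2015.LeafSupport.cm l)) κnoMok).TaibiInner (canon νtop (Mok2015.LeafSupport.mkN (Mok2015.LeafSupport.cm l)) κnoMok).GeeTaibi (canon₇₄ νtop (Mok2015.LeafSupport.mkN (Mok2015.LeafSupport.cm l)) κnoMok).FPWeaklyRegular).BGWthmB ∧ (canon₈₂W νtop (Mok2015.LeafSupport.mkN (Mok2015.LeafSupport.cm l)) ((canonShin νtop (Mok2015.LeafSupport.mkN (Mok2015.LeafSupport.cm l)) κnoMok).WeakS ∧ (canonShin νtop (Mok2015.LeafSupport.mkN (Mok2015.LeafSupport.cm l)) κnoMok).GalRepGLN)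 (canon νtop (Mok2015.LeafSupport.mkN (Mok2015.LeafSupport.cm l)) κnoMok).TaibiInner (canon νtop (Mok2015.LeafSupport.mkN (Mok2015.LeafSupport.cm l)) κnoMok).GeeTaibi (canon₇₄ νtop (Mok2015.LeafSupport.mkN (Mok2015.LeafSupport.cm l)) κnoMok).FPWeaklyRegular).BGWezc ∧ (canon₈₂W νtop (Mok2015.LeafSupport.mkN (Mok2015.LeafSupport.cm l)) ((canonShin νtop (Mok2015.LeafSupport.mkN (Mok2015.LeafSupport.cm l)) κnoMok).WeakS ∧ (canonShin νtop (Mok2015.LeafSupport.mkN (Mok2015.LeafSupport.cm l)) κnoMok).GalRepGLN) (canon νtop (Mok2015.LeafSupport.mkN (Mok2015.LeafSupport.cm l)) κnoMok).TaibiInner (canon νtop (Mok2015.LeafSupport.mkN (Mok2015.LeafSupport.cm l)) κnoMok).GeeTaibi (canon₇₄ νtop (Mok2015.LeafSupport.mkN (Mok2015.LeafSupport.cm l)) κnoMok).FPWeaklyRegular).XZgalois ∧ (canon₈₂W νtop (Mok2015.LeafSupport.mkN (Mok2015.LeafSupport.cm l)) ((canonShin νtop (Mok2015.LeafSupport.mkN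 (Mok2015.LeafSupport.cm l)) κnoMok).WeakS ∧ (canonShin νtop (Mok2015.LeafSupport.mkN (Mok2015.LeafSupport.cm l)) κnoMok).GalRepGLN) (canon νtop (Mok2015.LeafSupport.mkN (Mok2015.LeafSupport.cm l)) κnoMok).TaibiInner (canon νtop (Mok2015.LeafSupport.mkN (Mok2015.LeafSupport.cm l)) κnoMok).GeeTaibi (canon₇₄ νtop (Mok2015.LeafSupport.mkN (Mok2015.LeafSupport.cm l)) κnoMok).FPWeaklyRegular).XZRT ∧ (canon₈₂W νtop (Mok2015.LeafSupport.mkN (Mok2015.LeafSupport.cm l)) ((canonShin νtop (Mok2015.LeafSupport.mkN (Mok2015.LeafSupport.cm l)) κnoMok).WeakS ∧ (canonShin νtop (Mok2015.LeafSupport.mkN (Mok2015.LeafSupport.cm l)) κnoMok).GalRepGLN) (canon νtop (Mok2015.LeafSupport.mkN (Mok2015.LeafSupport.cm l)) κnoMok).TaibiInner (canon νtop (Mok2015.LeafSupport.mkN (Mok2015.LeafSupport.cm l)) κnoMok).GeeTaibi (canon₇₄ νtop (Mok2015.LeafSupport.mkN (Mok2015.LeafSupport.cm l)) κnoMok).FPWeaklyRegular).XZBK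 ∧ (canon₈₂W νtop (Mok2015.LeafSupport.mkN (Mok2015.LeafSupport.cm l)) ((canonShin νtop (Mok2015.LeafSupport.mkN (Mok2015.LeafSupport.cm l)) κnoMok).WeakS ∧ (canonShin νtop (Mok2015.LeafSupport.mkN (Mok2015.LeafSupport.cm l)) κnoMok).GalRepGLN) (canon νtop (Mok2015.LeafSupport.mkN (Mok2015.LeafSupport.cm l)) κnoMok).TaibiInner (canon νtop (Mok2015.LeafSupport.mkN (Mok2015.LeafSupport.cm l)) κnoMok).GeeTaibi (canon₇₄ νtop (Mok2015.LeafSupport.mkN (Mok2015.LeafSupport.cm l)) κnoMok).FPWeaklyRegular).ELstableTempered ∧ (canon₈₂W νtop (Mok2015.LeafSupport.mkN (Mok2015.LeafSupport.cm l)) ((canonShin νtop (Mok2015.LeafSupport.mkN (Mok2015.LeafSupport.cm l)) κnoMok).WeakS ∧ (canonShin νtop (Mok2015.LeafSupport.mkN (Mok2015.LeafSupport.cm l)) κnoMok).GalRepGLN) (canon νtop (Mok2015.LeafSupport.mkN (Mok2015.LeafSupport.cm l)) κnoMok).TaibiInner (canon νtop (Mok2015.LeafSupport.mkN (Mok2015.LeafSupport.cm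 l)) κnoMok).GeeTaibi (canon₇₄ νtop (Mok2015.LeafSupport.mkN (Mok2015.LeafSupport.cm l)) κnoMok).FPWeaklyRegular).ELmain) ∧ ¬ (canon₈₂W νtop (Mok2015.LeafSupport.mkN (Mok2015.LeafSupport.cm l)) ((canonShin νtop (Mok2015.LeafSupport.mkN (Mok2015.LeafSupport.cm l)) κnoMok).WeakS ∧ (canonShin νtop (Mok2015.LeafSupport.mkN (Mok2015.LeafSupport.cm l)) κnoMok).GalRepGLN) (canon νtop (Mok2015.LeafSupport.mkN (Mok2015.LeafSupport.cm l)) κnoMok).TaibiInner (canon νtop (Mok2015.LeafSupport.mkN (Mok2015.LeafSupport.cm l)) κnoMok).GeeTaibi (canon₇₄ νtop (Mok2015.LeafSupport.mkN (Mok2015.LeafSupport.cm l)) κnoMok).FPWeaklyRegular).BPweakRegLGC :=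
  have cmod := Mok2015.LeafSupport.countermodel l
  have nm := not_M_cm l
  have b : ∀ N, νtop.Everything N := bookInputs_top.everything
  have hW : (canonShin νtop (Mok2015.LeafSupport.mkN (Mok2015.LeafSupport.cm l)) κnoMok).WeakS := (weakS_mk _ _ _).2 (by decide)
  have X := canon_implications₈₂W νtop (Mok2015.LeafSupport.mkN (Mok2015.LeafSupport.cm l)) (canon νtop (Mok2015.LeafSupport.mkN (Mok2015.LeafSupport.cm l)) κnoMok) (canonShin νtop (Mok2015.LeafSupport.mkN (Mok2015.LeafSupport.cm l)) κnoMok) (canon₇₄ νtop (Mok2015.LeafSupport.mkN (Mok2015.LeafSupport.cm l)) κnoMok)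
  have hB := bgw_of_book X b
  have hX := xz_of_rows X hW trivial b b
  have hE := el_of_rows X b b b
  ⟨cmod.2.2.1, X, ⟨hB.1, hB.2.1, hB.2.2.1, hB.2.2.2, hX.1, hX.2.1, hX.2.2, hE.1, hE.2⟩, fun h => nm h.1⟩

/-- THE EIGHTY-SECOND TRANCHE REGRADED, in one statement: (i) at the top all ten hold; (ii) in the book countermodel of any leaf the book-citing statements of C206 /
C209 and C207's Bloch – Kato theorems fail, Theorem B and C208 hold, and C207's R ≃ 𝕋 holds iff the leaf is outside Shin's nine; (iii) for every Mok countermodel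
(KMSW without Mok, book at the top) C208 fails and the nine book-side statements hold. [cite: BarreraGrahamWilliams2025LGCEZC, Thms A–D; XZhang2024TaylorWilesOrthogonal, Thms 1.1, 1.5; BoxerPilloni2021HigherColeman, §6.11; EnnsLee2024ModpLGCGSp4, Thm 4.5.1 (bookkeeping proved here)] -/
theorem c82_regraded :
    (((canon₈₂W νtop μtop ((canonShin νtop μtop κtop).WeakS ∧ (canonShin νtop μtop κtop).GalRepGLN) (canon νtop μtop κtop).TaibiInner (canon νtop μtop κtop).GeeTaibi (canon₇₄ νtop μtop κtop).FPWeaklyRegular).BGWchar0 ∧ (canon₈₂W νtop μtop ((canonShin νtop μtop κtop).WeakS ∧ (canonShin νtop μtop κtop).GalRepGLN) (canon νtop μtop κtop).TaibiInner (canon νtop μtop κtop).GeeTaibi (canon₇₄ νtop μtop κtop).FPWeaklyRegular).BGWthmD ∧ (canon₈₂W νtop μtop ((canonShin νtop μtop κtop).WeakS ∧ (canonShin νtop μtop κtop).GalRepGLN) (canon νtop μtop κtop).TaibiInner (canon νtop μtop κtop).GeeTaibi (canon₇₄ νtop μtop κtop).FPWeaklyRegular).BGWthmB ∧ (canon₈₂W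 νtop μtop ((canonShin νtop μtop κtop).WeakS ∧ (canonShin νtop μtop κtop).GalRepGLN) (canon νtop μtop κtop).TaibiInner (canon νtop μtop κtop).GeeTaibi (canon₇₄ νtop μtop κtop).FPWeaklyRegular).BGWezc ∧ (canon₈₂W νtop μtop ((canonShin νtop μtop κtop).WeakS ∧ (canonShin νtop μtop κtop).GalRepGLN) (canon νtop μtop κtop).TaibiInner (canon νtop μtop κtop).GeeTaibi (canon₇₄ νtop μtop κtop).FPWeaklyRegular).XZgalois ∧ (canon₈₂W νtop μtop ((canonShin νtop μtop κtop).WeakS ∧ (canonShin νtop μtop κtop).GalRepGLN) (canon νtop μtop κtop).TaibiInner (canon νtop μtop κtop).GeeTaibi (canon₇₄ νtop μtop κtop).FPWeaklyRegular).XZRT ∧ (canon₈₂W νtop μtop ((canonShin νtop μtop κtop).WeakS ∧ (canonShin νtop μtop κtop).GalRepGLN) (canon νtop μtop κtop).TaibiInner (canon νtop μtop κtop).GeeTaibi (canon₇₄ νtop μtop κtop).FPWeaklyRegular).XZBK ∧ (canon₈₂W νtop μtop ((canonShin νtop μtop κtop).WeakS ∧ (canonShin νtop μtop κtop).GalRepGLN)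 (canon νtop μtop κtop).TaibiInner (canon νtop μtop κtop).GeeTaibi (canon₇₄ νtop μtop κtop).FPWeaklyRegular).ELstableTempered ∧ (canon₈₂W νtop μtop ((canonShin νtop μtop κtop).WeakS ∧ (canonShin νtop μtop κtop).GalRepGLN) (canon νtop μtop κtop).TaibiInner (canon νtop μtop κtop).GeeTaibi (canon₇₄ νtop μtop κtop).FPWeaklyRegular).ELmain) ∧ (canon₈₂W νtop μtop ((canonShin νtop μtop κtop).WeakS ∧ (canonShin νtop μtop κtop).GalRepGLN) (canon νtop μtop κtop).TaibiInner (canon νtop μtop κtop).GeeTaibi (canon₇₄ νtop μtop κtop).FPWeaklyRegular).BPweakRegLGC) ∧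
      (∀ l : LeafSupport.Leaf, (¬ (LeafSupport.mkN (LeafSupport.cm l)).leaf l) ∧ ¬ (canon₈₂W (LeafSupport.mkN (LeafSupport.cm l)) μtop ((canonShin (LeafSupport.mkN (LeafSupport.cm l)) μtop κtop).WeakS ∧ (canonShin (LeafSupport.mkN (LeafSupport.cm l)) μtop κtop).GalRepGLN) (canon (LeafSupport.mkN (LeafSupport.cm l)) μtop κtop).TaibiInner (canon (LeafSupport.mkN (LeafSupport.cm l)) μtop κtop).GeeTaibi (canon₇₄ (LeafSupport.mkN (LeafSupport.cm l)) μtop κtop).FPWeaklyRegular).BGWthmD ∧ ¬ (canon₈₂W (LeafSupport.mkN (LeafSupport.cm l)) μtop ((canonShin (LeafSupport.mkN (LeafSupport.cm l)) μtop κtop).WeakS ∧ (canonShin (LeafSupport.mkN (LeafSupport.cm l)) μtop κtop).GalRepGLN) (canon (LeafSupport.mkN (LeafSupport.cm l)) μtop κtop).TaibiInner (canon (LeafSupport.mkN (LeafSupport.cm l)) μtop κtop).GeeTaibi (canon₇₄ (LeafSupport.mkN (LeafSupport.cm l)) μtop κtop).FPWeaklyRegular).BGWezc ∧ (canon₈₂W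 (LeafSupport.mkN (LeafSupport.cm l)) μtop ((canonShin (LeafSupport.mkN (LeafSupport.cm l)) μtop κtop).WeakS ∧ (canonShin (LeafSupport.mkN (LeafSupport.cm l)) μtop κtop).GalRepGLN) (canon (LeafSupport.mkN (LeafSupport.cm l)) μtop κtop).TaibiInner (canon (LeafSupport.mkN (LeafSupport.cm l)) μtop κtop).GeeTaibi (canon₇₄ (LeafSupport.mkN (LeafSupport.cm l)) μtop κtop).FPWeaklyRegular).BGWthmB ∧
        ((canon₈₂W (LeafSupport.mkN (LeafSupport.cm l)) μtop ((canonShin (LeafSupport.mkN (LeafSupport.cm l)) μtop κtop).WeakS ∧ (canonShin (LeafSupport.mkN (LeafSupport.cm l)) μtop κtop).GalRepGLN) (canon (LeafSupport.mkN (LeafSupport.cm l)) μtop κtop).TaibiInner (canon (LeafSupport.mkN (LeafSupport.cm l)) μtop κtop).GeeTaibi (canon₇₄ (LeafSupport.mkN (LeafSupport.cm l)) μtop κtop).FPWeaklyRegular).XZRT ↔ l.shinS = false) ∧ ¬ (canon₈₂W (LeafSupport.mkN (LeafSupport.cm l)) μtop ((canonShin (LeafSupport.mkN (LeafSupport.cm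 l)) μtop κtop).WeakS ∧ (canonShin (LeafSupport.mkN (LeafSupport.cm l)) μtop κtop).GalRepGLN) (canon (LeafSupport.mkN (LeafSupport.cm l)) μtop κtop).TaibiInner (canon (LeafSupport.mkN (LeafSupport.cm l)) μtop κtop).GeeTaibi (canon₇₄ (LeafSupport.mkN (LeafSupport.cm l)) μtop κtop).FPWeaklyRegular).XZBK ∧ (canon₈₂W (LeafSupport.mkN (LeafSupport.cm l)) μtop ((canonShin (LeafSupport.mkN (LeafSupport.cm l)) μtop κtop).WeakS ∧ (canonShin (LeafSupport.mkN (LeafSupport.cm l)) μtop κtop).GalRepGLN) (canon (LeafSupport.mkN (LeafSupport.cm l)) μtop κtop).TaibiInner (canon (LeafSupport.mkN (LeafSupport.cm l)) μtop κtop).GeeTaibi (canon₇₄ (LeafSupport.mkN (LeafSupport.cm l)) μtop κtop).FPWeaklyRegular).BPweakRegLGC ∧ ¬ (canon₈₂W (LeafSupport.mkN (LeafSupport.cm l)) μtop ((canonShin (LeafSupport.mkN (LeafSupport.cm l)) μtop κtop).WeakS ∧ (canonShin (LeafSupport.mkN (LeafSupport.cm l)) μtop κtop).GalRepGLN) (canon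 (LeafSupport.mkN (LeafSupport.cm l)) μtop κtop).TaibiInner (canon (LeafSupport.mkN (LeafSupport.cm l)) μtop κtop).GeeTaibi (canon₇₄ (LeafSupport.mkN (LeafSupport.cm l)) μtop κtop).FPWeaklyRegular).ELmain) ∧
      (∀ l : Mok2015.LeafSupport.Leaf, (¬ (Mok2015.LeafSupport.mkN (Mok2015.LeafSupport.cm l)).leaf l) ∧ ((canon₈₂W νtop (Mok2015.LeafSupport.mkN (Mok2015.LeafSupport.cm l)) ((canonShin νtop (Mok2015.LeafSupport.mkN (Mok2015.LeafSupport.cm l)) κnoMok).WeakS ∧ (canonShin νtop (Mok2015.LeafSupport.mkN (Mok2015.LeafSupport.cm l)) κnoMok).GalRepGLN) (canon νtop (Mok2015.LeafSupport.mkN (Mok2015.LeafSupport.cm l)) κnoMok).TaibiInner (canon νtop (Mok2015.LeafSupport.mkN (Mok2015.LeafSupport.cm l)) κnoMok).GeeTaibi (canon₇₄ νtop (Mok2015.LeafSupport.mkN (Mok2015.LeafSupport.cm l)) κnoMok).FPWeaklyRegular).BGWchar0 ∧ (canon₈₂W νtop (Mok2015.LeafSupport.mkN (Mok2015.LeafSupport.cm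 l)) ((canonShin νtop (Mok2015.LeafSupport.mkN (Mok2015.LeafSupport.cm l)) κnoMok).WeakS ∧ (canonShin νtop (Mok2015.LeafSupport.mkN (Mok2015.LeafSupport.cm l)) κnoMok).GalRepGLN) (canon νtop (Mok2015.LeafSupport.mkN (Mok2015.LeafSupport.cm l)) κnoMok).TaibiInner (canon νtop (Mok2015.LeafSupport.mkN (Mok2015.LeafSupport.cm l)) κnoMok).GeeTaibi (canon₇₄ νtop (Mok2015.LeafSupport.mkN (Mok2015.LeafSupport.cm l)) κnoMok).FPWeaklyRegular).BGWthmD ∧ (canon₈₂W νtop (Mok2015.LeafSupport.mkN (Mok2015.LeafSupport.cm l)) ((canonShin νtop (Mok2015.LeafSupport.mkN (Mok2015.LeafSupport.cm l)) κnoMok).WeakS ∧ (canonShin νtop (Mok2015.LeafSupport.mkN (Mok2015.LeafSupport.cm l)) κnoMok).GalRepGLN) (canon νtop (Mok2015.LeafSupport.mkN (Mok2015.LeafSupport.cm l)) κnoMok).TaibiInner (canon νtop (Mok2015.LeafSupport.mkN (Mok2015.LeafSupport.cm l)) κnoMok).GeeTaibi (canon₇₄ νtop (Mok2015.LeafSupport.mkN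 (Mok2015.LeafSupport.cm l)) κnoMok).FPWeaklyRegular).BGWthmB ∧ (canon₈₂W νtop (Mok2015.LeafSupport.mkN (Mok2015.LeafSupport.cm l)) ((canonShin νtop (Mok2015.LeafSupport.mkN (Mok2015.LeafSupport.cm l)) κnoMok).WeakS ∧ (canonShin νtop (Mok2015.LeafSupport.mkN (Mok2015.LeafSupport.cm l)) κnoMok).GalRepGLN) (canon νtop (Mok2015.LeafSupport.mkN (Mok2015.LeafSupport.cm l)) κnoMok).TaibiInner (canon νtop (Mok2015.LeafSupport.mkN (Mok2015.LeafSupport.cm l)) κnoMok).GeeTaibi (canon₇₄ νtop (Mok2015.LeafSupport.mkN (Mok2015.LeafSupport.cm l)) κnoMok).FPWeaklyRegular).BGWezc ∧ (canon₈₂W νtop (Mok2015.LeafSupport.mkN (Mok2015.LeafSupport.cm l)) ((canonShin νtop (Mok2015.LeafSupport.mkN (Mok2015.LeafSupport.cm l)) κnoMok).WeakS ∧ (canonShin νtop (Mok2015.LeafSupport.mkN (Mok2015.LeafSupport.cm l)) κnoMok).GalRepGLN) (canon νtop (Mok2015.LeafSupport.mkN (Mok2015.LeafSupport.cm l)) κnoMok).TaibiInner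 (canon νtop (Mok2015.LeafSupport.mkN (Mok2015.LeafSupport.cm l)) κnoMok).GeeTaibi (canon₇₄ νtop (Mok2015.LeafSupport.mkN (Mok2015.LeafSupport.cm l)) κnoMok).FPWeaklyRegular).XZgalois ∧ (canon₈₂W νtop (Mok2015.LeafSupport.mkN (Mok2015.LeafSupport.cm l)) ((canonShin νtop (Mok2015.LeafSupport.mkN (Mok2015.LeafSupport.cm l)) κnoMok).WeakS ∧ (canonShin νtop (Mok2015.LeafSupport.mkN (Mok2015.LeafSupport.cm l)) κnoMok).GalRepGLN) (canon νtop (Mok2015.LeafSupport.mkN (Mok2015.LeafSupport.cm l)) κnoMok).TaibiInner (canon νtop (Mok2015.LeafSupport.mkN (Mok2015.LeafSupport.cm l)) κnoMok).GeeTaibi (canon₇₄ νtop (Mok2015.LeafSupport.mkN (Mok2015.LeafSupport.cm l)) κnoMok).FPWeaklyRegular).XZRT ∧ (canon₈₂W νtop (Mok2015.LeafSupport.mkN (Mok2015.LeafSupport.cm l)) ((canonShin νtop (Mok2015.LeafSupport.mkN (Mok2015.LeafSupport.cm l)) κnoMok).WeakS ∧ (canonShin νtop (Mok2015.LeafSupport.mkN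 (Mok2015.LeafSupport.cm l)) κnoMok).GalRepGLN) (canon νtop (Mok2015.LeafSupport.mkN (Mok2015.LeafSupport.cm l)) κnoMok).TaibiInner (canon νtop (Mok2015.LeafSupport.mkN (Mok2015.LeafSupport.cm l)) κnoMok).GeeTaibi (canon₇₄ νtop (Mok2015.LeafSupport.mkN (Mok2015.LeafSupport.cm l)) κnoMok).FPWeaklyRegular).XZBK ∧ (canon₈₂W νtop (Mok2015.LeafSupport.mkN (Mok2015.LeafSupport.cm l)) ((canonShin νtop (Mok2015.LeafSupport.mkN (Mok2015.LeafSupport.cm l)) κnoMok).WeakS ∧ (canonShin νtop (Mok2015.LeafSupport.mkN (Mok2015.LeafSupport.cm l)) κnoMok).GalRepGLN) (canon νtop (Mok2015.LeafSupport.mkN (Mok2015.LeafSupport.cm l)) κnoMok).TaibiInner (canon νtop (Mok2015.LeafSupport.mkN (Mok2015.LeafSupport.cm l)) κnoMok).GeeTaibi (canon₇₄ νtop (Mok2015.LeafSupport.mkN (Mok2015.LeafSupport.cm l)) κnoMok).FPWeaklyRegular).ELstableTempered ∧ (canon₈₂W νtop (Mok2015.LeafSupport.mkN (Mok2015.LeafSupport.cm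 l)) ((canonShin νtop (Mok2015.LeafSupport.mkN (Mok2015.LeafSupport.cm l)) κnoMok).WeakS ∧ (canonShin νtop (Mok2015.LeafSupport.mkN (Mok2015.LeafSupport.cm l)) κnoMok).GalRepGLN) (canon νtop (Mok2015.LeafSupport.mkN (Mok2015.LeafSupport.cm l)) κnoMok).TaibiInner (canon νtop (Mok2015.LeafSupport.mkN (Mok2015.LeafSupport.cm l)) κnoMok).GeeTaibi (canon₇₄ νtop (Mok2015.LeafSupport.mkN (Mok2015.LeafSupport.cm l)) κnoMok).FPWeaklyRegular).ELmain) ∧ ¬ (canon₈₂W νtop (Mok2015.LeafSupport.mkN (Mok2015.LeafSupport.cm l)) ((canonShin νtop (Mok2015.LeafSupport.mkN (Mok2015.LeafSupport.cm l)) κnoMok).WeakS ∧ (canonShin νtop (Mok2015.LeafSupport.mkN (Mok2015.LeafSupport.cm l)) κnoMok).GalRepGLN) (canon νtop (Mok2015.LeafSupport.mkN (Mok2015.LeafSupport.cm l)) κnoMok).TaibiInner (canon νtop (Mok2015.LeafSupport.mkN (Mok2015.LeafSupport.cm l)) κnoMok).GeeTaibi (canon₇₄ νtop (Mok2015.LeafSupport.mkN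 (Mok2015.LeafSupport.cm l)) κnoMok).FPWeaklyRegular).BPweakRegLGC) :=
  ⟨eightysecond_holds_top,
    fun l => have h := c82_book_cm l
      ⟨h.2.2.1, h.2.2.2.2.1, h.2.2.2.2.2.2.1, h.2.2.2.2.2.1, h.2.2.2.2.2.2.2.1, h.2.2.2.2.2.2.2.2.1, h.2.2.2.2.2.2.2.2.2.1, h.2.2.2.2.2.2.2.2.2.2.2⟩,
    fun l => have h := c82_mok_cm l
      ⟨h.1, h.2.2.1, h.2.2.2⟩⟩

end Support

end Downstream

end Literature.NumberTheory.Automorphic.Arthur2013
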